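import Literature.NumberTheory.LFunctions.RodgersTaoHamiltonianProofs
import Literature.NumberTheory.LFunctions.RodgersTaoGapBoundProofs
import Mathlib.Analysis.PSeries
import Mathlib.NumberTheory.Harmonic.Bounds
import HarnessLib

/-!
# Rodgers–Tao 2020, Lemma 18 (= v4 Lemma 7.3): the expansion of the truncated energy `Ẽ_T` —
RH-FREE CONTENT TWIN (the `p. 42–43` display, the schema pointwise in `t`, the as-printed
reduction)

Proofs only: no named facts and no `def`s — the zero-extended summand
`g_j(k) := ψ_T(k)/(ξ_k − ξ_j)³` (`0` at `k = 0` and `k = j`), its majorant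
`4(Q³ + log₊³ m)/(c³|m|³)`, the profiles `(1 + |j|/N)^{−q}` and the desymmetrised summands
`2ψ_T(j)(x_j(t) − ξ_j) g_j(k)` are written out explicitly in the (private) lemmas.
Trunk T-ANT (`Literature/NumberTheory/LFunctions`).
Companion of `RodgersTaoHamiltonian.lean` (which types Lemma 18 AS PRINTED as the named fact
`rodgers_tao_truncEnergy_expansion`, VACUOUS-AS-PRINTED (Λ ≥ 0) / EX-FALSO class, discharged ex
falso in `RodgersTaoHamiltonianProofs.lean`) and sibling of
`RodgersTaoTruncEnergyExpansionProofs.lean` (the indicator-over-`ℤ`, `log³ T · (1/|j| + 1/T)` form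
of the same `p. 42–43` display; the present file proves the subtype-carrier,
`log₊⁴ j · (1/|j| + 1/(T log T))` form independently — two theorem forms of one printed display,
neither claims the other's constant, no import either way).

Source: B. Rodgers, T. Tao, *The de Bruijn–Newman constant is non-negative*, Forum Math. Pi 8
(2020) e6 = arXiv:1801.05914, **Lemma 18** (FMP p. 42, proof pp. 42–43) = arXiv v4 Lemma 7.3 =
v5 TeX l. 1059–1084 (label `eb2`), OPENED and followed: «For almost every `Λ/2 ≤ t ≤ 0`, one has
`Ẽ_T(t) = (Σ_{j,k ∈ ℤ*: j ≠ k} ψ_T(j)ψ_T(k)(E_{jk}(t) − 1/|ξ_k − ξ_j|²)) + Õ(1)`. *Proof.* For almost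
every `t`, one sees from Proposition 15, (66), and Fubini's theorem (and (51)) that the series
`Σ_{j ≠ k} ψ_T(j)ψ_T(k)(E_{jk}(t) + 1/|ξ_k − ξ_j|² + (|x_j(t)| + |x_k(t)|)/|ξ_k − ξ_j|³)` is absolutely
convergent. Thus, by Fubini's theorem and (63), it will suffice to show that
`Σ_{j,k ∈ ℤ*: j ≠ k} ψ_T(j)ψ_T(k)((x_k(t) − ξ_k) − (x_j(t) − ξ_j))/(ξ_k − ξ_j)³ ≲ 1`. We may
desymmetrize the left-hand side (again using Fubini's theorem) as
`2 Σ_{j ∈ ℤ*} ψ_T(j)(x_j(t) − ξ_j) Σ_{k ∈ ℤ*: k ≠ j} ψ_T(k)/(ξ_k − ξ_j)³`, and so it will suffice to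
establish the bound `Σ_{k ∈ ℤ*: k ≠ j} ψ_T(k)/(ξ_k − ξ_j)³ ≲ 1/|j| + 1/T` for all `j ∈ ℤ*`. As in the
proof of Lemma 16, we see from (44) that the contribution of those `k` with `|k − j| ≥ j/2` is
acceptable. For the remaining range `|k − j| < j/2`, we again use (45) to estimate
`1/(ξ_k − ξ_j)³ = (log³ ξ_j/(4π)³) · 1/(k − j)³ + Õ(1/(j (k − j)²))` and similarly
`ψ_T(k) = ψ_T(j) + Õ(|k − j|/T)`, and the claim follows by direct computation using the fact that
`k ↦ 1/(k − j)` is odd around `j`.» (`≲`, `Õ` = up to `log^{O(1)} T` factors, §1.2.)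

LINE 1 — LABEL. **RH-FREE CONTENT** (0 named facts, 0 sorries): statements about the classical
locations `ξ_j` (`classicalLocationZ`), the weight `ψ_T` (`truncWeight`, (66)) and — in Parts B/C —
the zeros `x_j(t)` at a time `t` lying above a real-rooted time and obeying a (50)-shape location
law taken AS A HYPOTHESIS. Nothing is asserted about `Λ`, about `t ≤ 0`, or about (50) holding at
any `t ≥ Λ ≥ 0`; the as-printed Lemma 18 record `rodgers_tao_truncEnergy_expansion` stays
VACUOUS-AS-PRINTED / EX-FALSO (its discharge of record is the ex-falso
`rodgers_tao_truncEnergy_expansion_holds`; NO second `_holds` is given here). bears_on: N-C/N-P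
(COLUMN 3 DBN). WHAT THIS IS NOT: not Lemma 18 at `t = 0` (that would need (50) at `t = 0`, an
RH-strength input), not a statement about `H_0` or `ζ`, not progress toward RH — formalising the
printed argument fixes which inputs ((44), (45), (50), (63), a.e. finiteness of `Ẽ_T`) the
expansion needs; nothing in this file bears on the truth of the Riemann hypothesis.

## Contents (source item → declaration → status; namespace `Literature.NumberTheory.LFunctions`)

Part A (the `p. 42–43` display, `t`-free):
* `abs_tsum_truncWeight_div_cube_le` — «`Σ_{k ∈ ℤ*: k ≠ j} ψ_T(k)/(ξ_k − ξ_j)³ ≲ 1/|j| + 1/T` for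
  all `j ∈ ℤ*`», typed with explicit losses: `∃ K ≥ 0, ∀ T ≥ 3, ∀ j ≠ 0`, the family on
  `zstarCompl {j}` is summable and `|Σ'| ≤ K · log₊⁴ j · (1/|j| + 1/(T log T))`. PROVED
  (CONTENT) from (43)–(45): `RodgersTao2020.lemma31_ii_holds_record` (44),
  `RodgersTao2020.lemma31_iii_holds` (45, corrected form), `lemma8_i_order` (43).
* Toolkit (namespace `RodgersTaoTruncEnergyExpansion`; public): `abs_truncWeight_sub_le`
  (`|ψ_T(k) − ψ_T(j)| ≤ 100|k − j|/(T log T)`, the printed «`ψ_T(k) = ψ_T(j) + Õ(|k − j|/T)`»),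
  `exists_constants` ((43)–(45) packaged), the symmetrised near pair `abs_pair_le` (pure
  inequality), `abs_deviation_le` ((50) on all of `ℤ`), the weighted sums
  `tsum_truncWeight_mul_logPlus_pow_le(')` (`Σ_j ψ_T(j) log₊^p j ≤ 10·3^p·T log T·log^p T`) and
  `tsum_truncWeight_mul_logPlus_pow_div_le` (`Σ_j ψ_T(j) log₊^p j/|j| ≤ 16·3^p·log^{p+1} T`);
  private: the oddness of the zero-extended summand, the subtype ↔ `ℤ`-sum bridge, the majorant
  and summability, the far tail over `|k − j| > M`, the near pair over the classical locations,
  the per-`j` bound for `j ≥ 1` and for `j ∈ ℤ*`.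

Part B (Lemma 18 as an RH-FREE schema, pointwise in `t`):
* `rodgers_tao_truncEnergy_expansion_of` — `∃ C ≥ 0, ∀ B T t, 3 ≤ T →
  (∃ t₁ < t, HasOnlyRealZeros (H_{t₁})) → (∀ n ≥ 1, |x_n(t) − ξ_n| ≤ B log₊ ξ_n) →` (1) the
  (63)-correction family `ψ_T(j)ψ_T(k)·2((x_k − ξ_k) − (x_j − ξ_j))/(ξ_k − ξ_j)³` is summable on the
  pairs `j ≠ k` of `ℤ*`; (2) `|Σ'| ≤ C·max(B,0)·log⁶ T`; (3) `Summable Ẽ_T(t) ↔ Summable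
  Σψψ(E_{jk} − 1/(ξ_k − ξ_j)²)`; (4) `Summable Ẽ_T(t) → |Ẽ_T(t) − Σ'ψψ(E_{jk} − 1/(ξ_k − ξ_j)²)| ≤
  C·max(B,0)·log⁶ T`. PROVED (CONTENT); hypotheses = the INNER shape of
  `RodgersTao2020.cor33_location` at the time `t` (t2's «H2»), `C` absolute (uniform in `t`,
  linear in `B`). Private toolkit: the desymmetrised summand `F(j,k) = 2ψ_T(j)(x_j − ξ_j)g_j(k)` on
  `ℤ × ℤ` (absolute summability by a product majorant, Fubini, `|Σ F| ≤ C·max(B,0)·log⁶ T`) and the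
  symmetric summand `−F(k,j) − F(j,k)`, which is the (63)-correction on `ℤ* × ℤ* ∖ Δ`, vanishes
  elsewhere, and sums to `−2 Σ F` (swap invariance).

Part C (the as-printed implication):
* `rodgers_tao_truncEnergy_expansion_of_cor33_location :
  RodgersTao2020.cor33_location → (∀ t₀ < 0, HasOnlyRealZeros (H_{t₀}) → ∃ T₁, ∀ T ≥ T₁,
  ∀ᵐ t ∈ [t₀/2, 0], Summable (truncEnergyTerm T t)) → rodgers_tao_truncEnergy_expansion`
  (`A = 6`, `C = C_B · max(A₅₀, 0)`, `T₁ ↦ max T₁ 3`). The second hypothesis is the sentence of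
  p. 42 after (67) («from Proposition 15, (66), (62) and Fubini's theorem … `Ẽ_T` … is finite for
  almost every `Λ/2 ≤ t ≤ 0`») in its typed shape, stated INLINE (not a named fact).

## Proof route and divergences (rt/REFEREE §6)

* Near/far split at `|k − j| ≤ |j|/2` (`j ≥ 1`; `j ≤ −1` by the oddness `g_{−j}(−k) = −g_j(k)`).
  Far range: (44) gives `1/|ξ_k − ξ_j|³ ≤ log₊³(|ξ_j| + |ξ_k|)/(c³|k − j|³)` and
  `log₊(|ξ_j| + |ξ_k|) ≤ log(2 + B) + 2 log₊ j + log₊(k − j)`; with `|ψ_T| ≤ 1` the tail over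
  `|k − j| > |j|/2` is `O(log₊³ j/|j|)` (`Σ_m log₊³ m/m² < ∞`). Near range: the pairs `k = j ± n`
  are summed together; instead of expanding `1/(ξ_k − ξ_j)³` around `(log ξ_j/4π)³/(k − j)³` we use
  (45) (corrected main term `4π(k − j)/log(ξ_j/4π)`, tree form) at `k = j + n` AND `k = j − n`:
  only the SECOND DIFFERENCE `(ξ_{j+n} − ξ_j) − (ξ_j − ξ_{j−n}) = O(n²/j)` enters, the main terms
  cancel in pairs («`k ↦ 1/(k − j)` is odd around `j`»), so the E7 correction of (45) is visibly
  immaterial here, as `RodgersTaoRiemannVonMangoldt.lean` records. Result: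
  `|Σ_k g_j(k)| ≤ K log₊⁴ j (1/|j| + 1/(T log T))` — the printed `≲ 1/|j| + 1/T` with the
  `log^{O(1)}` losses explicit (`log₊⁴ j`; for `|j| ≲ T log T` this is `≲ log⁴ T`).
* `Õ(1)` of Lemma 18 explicit: `C · max(B,0) · log⁶ T` at `T ≥ 3` (`log⁴` from Part A, one
  `log₊ ξ_j ≤ C₈ log₊ j` from (50), one from the harmonic sum `Σ_{|j| ≤ T log T} 1/|j|`).
* Desymmetrisation constant: (63) carries the factor `2` and the double sum counts both orders, so
  `Σ_{j ≠ k} ψψ·2((x_k − ξ_k) − (x_j − ξ_j))/(ξ_k − ξ_j)³ = −4 Σ_j ψ_T(j)(x_j − ξ_j) S_j` (the source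
  prints «`2Σ_j …`»; immaterial). Fubini is run on `ℤ × ℤ` with the zero-extended summand
  `2ψ_T(j)(x_j − ξ_j) g_j(k)` (absolutely summable: majorant
  `2ψ_T(j) · max(B,0) C₈ log₊ j · maj(k − j)` with summable rows and `Σ_j ψ_T(j) log₊⁴ j < ∞`), and
  the off-diagonal `ℤ*`-pairs enter through `tsum_subtype_eq_of_support_subset`.
* Pointwise in `t`, not «almost every `t`»: the printed a.e. qualifier only carries the
  a.e.-finiteness of `Ẽ_T(t)` (Prop. 15 + Fubini), which is the hypothesis of (4) / the
  equivalence (3) in Part B and the inline hypothesis of Part C; the expansion itself holds at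
  every admissible `t`.
* `T ≥ 3` stands for «`T` large» (p. 42), so that `T log T ≥ 3` and `log T ≥ 1`; real exponent
  `A = 6` in Part C via `Real.rpow_natCast`.

## References

* B. Rodgers, T. Tao, *The de Bruijn–Newman constant is non-negative*, Forum Math. Pi 8 (2020)
  e6, §7 Lemma 18 p. 42 (proof pp. 42–43), (63) p. 40, (66)–(67) p. 42; §3 Lemma 8 (43)–(45)
  p. 21, Corollary 10 (50) p. 23; §1.2 p. 7 (`log₊`, `Õ`, `≲`) = arXiv:1801.05914v4 Lemma 7.3,
  v5 TeX l. 1040–1084.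
* A. Dobner, *A proof of Newman's conjecture for the extended Selberg class*, Acta Arith. 201
  (2021) 29–62 (the tree's route to `Λ ≥ 0`, which makes the as-printed Lemma 18 vacuous).
-/

noncomputable section

open Real Set Filter Topology MeasureTheory

namespace Literature.NumberTheory.LFunctions

namespace RodgersTaoTruncEnergyExpansion

/-! ### A.0 Elementary facts: `T ≥ 3`, the weight `ψ_T`, `log₊` -/

/-- For `T ≥ 3`: `1 ≤ log T`, `3 ≤ T log T` and `log(2 + T log T) ≤ 2 log T`. [folklore] -/
private theorem basic_T {T : ℝ} (hT : 3 ≤ T) :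
    1 ≤ Real.log T ∧ 3 ≤ T * Real.log T ∧ Real.log (2 + T * Real.log T) ≤ 2 * Real.log T := by
  have hT0 : 0 < T := by linarith
  have hlogT : 1 ≤ Real.log T := by
    rw [← Real.log_exp 1]
    exact Real.log_le_log (Real.exp_pos 1) (by have := Real.exp_one_lt_d9; linarith)
  refine ⟨hlogT, by nlinarith, ?_⟩
  have h1 : Real.log T ≤ T - 1 := by have := Real.log_le_sub_one_of_pos hT0; linarith
  have h2 : 2 + T * Real.log T ≤ T ^ 2 := by nlinarith
  calc Real.log (2 + T * Real.log T) ≤ Real.log (T ^ 2) :=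
        Real.log_le_log (by positivity) h2
    _ = 2 * Real.log T := by rw [Real.log_pow]; norm_num

/-- `|(1+a)^{-n} − (1+b)^{-n}| ≤ n |a − b|` for `a, b ≥ 0` (the profile of `ψ_T` is
`100`-Lipschitz on `[0, ∞)`). [folklore] -/
private theorem abs_inv_pow_sub_inv_pow_le (n : ℕ) {a b : ℝ} (ha : 0 ≤ a) (hb : 0 ≤ b) :
    |((1 + a) ^ n)⁻¹ - ((1 + b) ^ n)⁻¹| ≤ n * |a - b| := by
  wlog hab : a ≤ b generalizing a b
  · have h := this hb ha (le_of_not_ge hab)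
    rwa [abs_sub_comm, abs_sub_comm b a] at h
  have hpa : 0 < (1 + a) ^ n := by positivity
  have hpb : 0 < (1 + b) ^ n := by positivity
  have hmono : (1 + a) ^ n ≤ (1 + b) ^ n := pow_le_pow_left₀ (by linarith) (by linarith) n
  have hnn : 0 ≤ ((1 + a) ^ n)⁻¹ - ((1 + b) ^ n)⁻¹ :=
    sub_nonneg.2 (inv_anti₀ hpa hmono)
  rw [abs_of_nonneg hnn, abs_of_nonpos (show a - b ≤ 0 by linarith), neg_sub]
  -- `(1+b)^n − (1+a)^n ≤ (b − a) · n · (1+b)^(n-1)`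
  have hnum : (1 + b) ^ n - (1 + a) ^ n ≤ (b - a) * n * (1 + b) ^ (n - 1) := by
    have h := abs_pow_sub_pow_le (a := 1 + b) (b := 1 + a) (n := n)
    have h1 : |(1 + b) ^ n - (1 + a) ^ n| = (1 + b) ^ n - (1 + a) ^ n :=
      abs_of_nonneg (by linarith)
    have h2 : |(1 + b) - (1 + a)| = b - a := by rw [abs_of_nonneg (by linarith)]; ring
    have h3 : max |1 + b| |1 + a| = 1 + b := by
      rw [abs_of_pos (by linarith), abs_of_pos (by linarith)]
      exact max_eq_left (by linarith)
    rw [h1, h2, h3] at h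
    exact h
  have h99 : (1 + b) ^ (n - 1) ≤ (1 + a) ^ n * (1 + b) ^ n := by
    have h1 : (1 : ℝ) ≤ (1 + a) ^ n := one_le_pow₀ (by linarith)
    have h2 : (1 + b) ^ (n - 1) ≤ (1 + b) ^ n := pow_le_pow_right₀ (by linarith) (Nat.sub_le n 1)
    have h3 : (0 : ℝ) < (1 + b) ^ (n - 1) := by positivity
    nlinarith
  have hba : 0 ≤ b - a := by linarith
  have hn0 : (0 : ℝ) ≤ n := Nat.cast_nonneg n
  have key : (1 + b) ^ n - (1 + a) ^ n ≤ n * (b - a) * ((1 + a) ^ n * (1 + b) ^ n) := by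
    have : (b - a) * n * (1 + b) ^ (n - 1) ≤ (b - a) * n * ((1 + a) ^ n * (1 + b) ^ n) :=
      mul_le_mul_of_nonneg_left h99 (mul_nonneg hba hn0)
    linarith
  rw [inv_sub_inv hpa.ne' hpb.ne', div_le_iff₀ (by positivity)]
  linarith

/-- The weight `ψ_T` is `100/(T log T)`-Lipschitz in the index:
`|ψ_T(k) − ψ_T(j)| ≤ 100 |k − j|/(T log T)` (for `T log T > 0`).
[cite: RodgersTaoFMP2020, §7 p. 42 (66); Lemma 18 p. 42 (proof: «ψ_T(k) = ψ_T(j) + Õ(|k−j|/T)»)] -/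
theorem abs_truncWeight_sub_le {T : ℝ} (hT : 0 < T * Real.log T) (j k : ℤ) :
    |truncWeight T k - truncWeight T j| ≤ 100 * |(k : ℝ) - j| / (T * Real.log T) := by
  rw [truncWeight_eq, truncWeight_eq]
  have h := abs_inv_pow_sub_inv_pow_le 100 (a := |(k : ℝ)| / (T * Real.log T))
    (b := |(j : ℝ)| / (T * Real.log T)) (by positivity) (by positivity)
  push_cast at h
  refine h.trans ?_
  rw [← sub_div, abs_div, abs_of_pos hT, mul_div_assoc]
  exact mul_le_mul_of_nonneg_left
    (div_le_div_of_nonneg_right (abs_abs_sub_abs_le_abs_sub (k : ℝ) (j : ℝ)) hT.le) (by norm_num)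

/-- `log₊ x ≤ (2 + |x|)^ε / ε` for `ε > 0`. [folklore] -/
private theorem logPlus_le_rpow_div (x : ℝ) {ε : ℝ} (hε : 0 < ε) :
    logPlus x ≤ (2 + |x|) ^ ε / ε := by
  rw [logPlus_eq]
  exact Real.log_le_rpow_div (by positivity) hε

/-- `log₊³ m ≤ 216 √3 · |m|^{1/2}` for an integer `m ≠ 0`. [folklore] -/
private theorem logPlus_cube_le {m : ℤ} (hm : m ≠ 0) :
    logPlus m ^ 3 ≤ 216 * Real.sqrt 3 * |(m : ℝ)| ^ (1 / 2 : ℝ) := by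
  have hm1 : (1 : ℝ) ≤ |(m : ℝ)| := by
    rw [← Int.cast_abs]; exact_mod_cast Int.one_le_abs hm
  have h0 : (0 : ℝ) ≤ 2 + |(m : ℝ)| := by positivity
  have h1 : logPlus (m : ℝ) ≤ (2 + |(m : ℝ)|) ^ (1 / 6 : ℝ) / (1 / 6) :=
    logPlus_le_rpow_div _ (by norm_num)
  have h2 : logPlus (m : ℝ) ≤ 6 * (2 + |(m : ℝ)|) ^ (1 / 6 : ℝ) := by
    rw [div_eq_mul_inv] at h1; norm_num at h1; linarith
  have h3 : logPlus (m : ℝ) ^ 3 ≤ (6 * (2 + |(m : ℝ)|) ^ (1 / 6 : ℝ)) ^ 3 :=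
    pow_le_pow_left₀ (logPlus_nonneg _) h2 3
  have h4 : ((2 + |(m : ℝ)|) ^ (1 / 6 : ℝ)) ^ 3 = (2 + |(m : ℝ)|) ^ (1 / 2 : ℝ) := by
    rw [← Real.rpow_natCast, ← Real.rpow_mul h0]; norm_num
  have h5 : (2 + |(m : ℝ)|) ^ (1 / 2 : ℝ) ≤ Real.sqrt 3 * |(m : ℝ)| ^ (1 / 2 : ℝ) := by
    rw [Real.sqrt_eq_rpow, ← Real.mul_rpow (by norm_num) (by positivity)]
    exact Real.rpow_le_rpow h0 (by linarith) (by norm_num)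
  calc logPlus (m : ℝ) ^ 3 ≤ (6 * (2 + |(m : ℝ)|) ^ (1 / 6 : ℝ)) ^ 3 := h3
    _ = 216 * (2 + |(m : ℝ)|) ^ (1 / 2 : ℝ) := by rw [mul_pow, h4]; norm_num
    _ ≤ 216 * (Real.sqrt 3 * |(m : ℝ)| ^ (1 / 2 : ℝ)) := by gcongr
    _ = 216 * Real.sqrt 3 * |(m : ℝ)| ^ (1 / 2 : ℝ) := by ring

/-- The series `Σ_{m ∈ ℤ} log₊³ m / m²` converges (value `0` at `m = 0`). [folklore] -/
private theorem summable_logPlus_cube_div_sq :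
    Summable (fun m : ℤ ↦ logPlus m ^ 3 / (m : ℝ) ^ 2) := by
  have hs : Summable (fun m : ℤ ↦ 216 * Real.sqrt 3 * |(m : ℝ)| ^ (-(3 / 2) : ℝ)) :=
    (Real.summable_abs_int_rpow (by norm_num : (1 : ℝ) < 3 / 2)).mul_left _
  refine Summable.of_nonneg_of_le
    (fun m ↦ div_nonneg (pow_nonneg (logPlus_nonneg _) 3) (sq_nonneg _)) (fun m ↦ ?_) hs
  rcases eq_or_ne m 0 with rfl | hm
  · simp
  have hmpos : (0 : ℝ) < |(m : ℝ)| := by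
    have : (1 : ℝ) ≤ |(m : ℝ)| := by rw [← Int.cast_abs]; exact_mod_cast Int.one_le_abs hm
    linarith
  have h2 : (m : ℝ) ^ 2 = |(m : ℝ)| ^ (2 : ℝ) := by
    rw [← sq_abs, ← Real.rpow_natCast]; norm_num
  calc logPlus m ^ 3 / (m : ℝ) ^ 2 ≤ 216 * Real.sqrt 3 * |(m : ℝ)| ^ (1 / 2 : ℝ) / (m : ℝ) ^ 2 := by
        gcongr; exact logPlus_cube_le hm
    _ = 216 * Real.sqrt 3 * (|(m : ℝ)| ^ (1 / 2 : ℝ) / |(m : ℝ)| ^ (2 : ℝ)) := by rw [h2]; ring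
    _ = 216 * Real.sqrt 3 * |(m : ℝ)| ^ (-(3 / 2) : ℝ) := by
        rw [← Real.rpow_sub hmpos]; norm_num

/-- The series `Σ_{m ∈ ℤ} 1/m²` converges (value `0` at `m = 0`). [folklore] -/
private theorem summable_one_div_sq : Summable (fun m : ℤ ↦ 1 / (m : ℝ) ^ 2) :=
  Real.summable_one_div_int_pow.2 (by norm_num)

/-- `Σ_{m ∈ ℤ} 1/m² ≤ 4`. [folklore] -/
private theorem tsum_one_div_sq_le : ∑' m : ℤ, 1 / (m : ℝ) ^ 2 ≤ 4 := by
  have hs := summable_one_div_sq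
  have hnat : Summable (fun n : ℕ ↦ 1 / (n : ℝ) ^ 2) :=
    Real.summable_one_div_nat_pow.2 (by norm_num)
  have hle : ∑' n : ℕ, 1 / (n : ℝ) ^ 2 ≤ 2 := by
    refine Real.tsum_le_of_sum_range_le (fun n ↦ by positivity) fun n ↦ ?_
    have h := sum_Ioo_inv_sq_le (α := ℝ) 0 n
    have h2 : ∑ i ∈ Finset.range n, 1 / ((i : ℕ) : ℝ) ^ 2 =
        ∑ i ∈ Finset.Ioo 0 n, ((i : ℝ) ^ 2)⁻¹ := by
      rw [Finset.range_eq_Ico]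
      have : Finset.Ico 0 n = insert 0 (Finset.Ioo 0 n) ∨ n = 0 := by
        rcases Nat.eq_zero_or_pos n with rfl | hn
        · exact Or.inr rfl
        · left; ext i; simp [Finset.mem_Ioo]; omega
      rcases this with h3 | rfl
      · rw [h3, Finset.sum_insert (by simp)]
        simp [one_div]
      · simp
    rw [h2]
    norm_num at h
    linarith
  have h1 : HasSum (fun n : ℕ ↦ 1 / ((n : ℤ) : ℝ) ^ 2 + 1 / ((-(n : ℤ) : ℤ) : ℝ) ^ 2)
      (∑' m : ℤ, 1 / (m : ℝ) ^ 2 + 1 / ((0 : ℤ) : ℝ) ^ 2) := hs.hasSum.nat_add_neg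
  have h2 : (fun n : ℕ ↦ 1 / ((n : ℤ) : ℝ) ^ 2 + 1 / ((-(n : ℤ) : ℤ) : ℝ) ^ 2) =
      fun n : ℕ ↦ 2 * (1 / (n : ℝ) ^ 2) := by
    ext n; push_cast; ring
  rw [h2] at h1
  have h3 : ∑' n : ℕ, 2 * (1 / (n : ℝ) ^ 2) = 2 * ∑' n : ℕ, 1 / (n : ℝ) ^ 2 := tsum_mul_left
  have h4 := h1.tsum_eq
  have h5 : (1 : ℝ) / ((0 : ℤ) : ℝ) ^ 2 = 0 := by simp
  rw [h3, h5, add_zero] at h4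
  linarith


/-- `(a + b)³ ≤ 4 (a³ + b³)` for `a, b ≥ 0`. [folklore] -/
private theorem add_pow_three_le {a b : ℝ} (ha : 0 ≤ a) (hb : 0 ≤ b) :
    (a + b) ^ 3 ≤ 4 * (a ^ 3 + b ^ 3) := by
  nlinarith [sq_nonneg (a - b), mul_nonneg ha hb, mul_nonneg (mul_nonneg ha hb) (add_nonneg ha hb)]

/-! ### A.1 The constants of (43)–(45) over the carriers of record -/

/-- The constants used below, from Rodgers–Tao 2020 Lemma 8 = (43)–(45) (tree theorems
`RodgersTao2020.lemma31_i_order_holds`, `lemma31_ii_holds_record`, `lemma31_iii_holds`,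
`exists_abs_classicalLocationZ_le`): `c (k−j)/log₊(|ξ_j|+|ξ_k|) ≤ |ξ_k − ξ_j| ≤ C (…)` on `ℤ*`,
`|ξ_k| ≤ B |k|` on `ℤ`, `c₈ log₊ y ≤ log₊ ξ_y ≤ C₈ log₊ y` for real `y ≥ 1`, and the corrected
(45) with comparability constant `K = 2`.
[cite: RodgersTaoFMP2020, Lemma 8 (43)–(45) p. 21] -/
theorem exists_constants :
    ∃ c C B c₈ C₈ A : ℝ, 0 < c ∧ c ≤ C ∧ 0 < B ∧ 0 < c₈ ∧ c₈ ≤ C₈ ∧ 0 ≤ A ∧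
      (∀ j k : ℤ, j ≠ 0 → k ≠ 0 →
        c * (|(k : ℝ) - j| / logPlus (|classicalLocationZ j| + |classicalLocationZ k|)) ≤
            |classicalLocationZ k - classicalLocationZ j| ∧
          |classicalLocationZ k - classicalLocationZ j| ≤
            C * (|(k : ℝ) - j| / logPlus (|classicalLocationZ j| + |classicalLocationZ k|))) ∧
      (∀ k : ℤ, |classicalLocationZ k| ≤ B * |(k : ℝ)|) ∧
      (∀ y : ℝ, 1 ≤ y → c₈ * logPlus y ≤ logPlus (classicalLocation y) ∧
        logPlus (classicalLocation y) ≤ C₈ * logPlus y) ∧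
      (∀ j k : ℝ, 1 ≤ j → 1 ≤ k → j ≤ 2 * k → k ≤ 2 * j →
        |classicalLocation k - classicalLocation j -
            4 * π * (k - j) / Real.log (classicalLocation j / (4 * π))| ≤
          A * ((k - j) ^ 2 / (j * Real.log (classicalLocation j) ^ 2))) := by
  obtain ⟨c, C, hc, hcC, h44⟩ := RodgersTao2020.lemma31_ii_holds_record
  obtain ⟨B, hB, h43⟩ := exists_abs_classicalLocationZ_le
  obtain ⟨c₈, C₈, hc₈, hc₈C₈, hord⟩ := lemma8_i_order
  obtain ⟨A, h45⟩ := RodgersTao2020.lemma31_iii_holds 2 (by norm_num)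
  refine ⟨c, C, B, c₈, C₈, max A 0, hc, hcC, hB, hc₈, hc₈C₈, le_max_right _ _, h44, h43,
    fun y hy ↦ ⟨(hord y hy).2.2.1, (hord y hy).2.2.2⟩, fun j k hj hk hjk hkj ↦ ?_⟩
  refine (h45 j k hj hk hjk hkj).trans (mul_le_mul_of_nonneg_right (le_max_left _ _) ?_)
  have : 0 < classicalLocation j := classicalLocation_pos (by linarith)
  positivity

/-- `log ξ_y ≥ 1` for real `y ≥ −1` (`ξ_y ≥ 4π > e`). [cite: RodgersTaoFMP2020, §3 (42) p. 21] -/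
theorem one_le_log_classicalLocation {y : ℝ} (hy : -1 ≤ y) :
    1 ≤ Real.log (classicalLocation y) := by
  have h4 := four_pi_le_classicalLocation hy
  have he : Real.exp 1 ≤ classicalLocation y := by
    have := Real.exp_one_lt_d9; have := Real.pi_gt_three; linarith
  rw [← Real.log_exp 1]
  exact Real.log_le_log (Real.exp_pos 1) he

/-- `log₊(|a| + |b|) ≤ log(2 + B) + log₊ j + log₊ k` when `|a| ≤ B|j|`, `|b| ≤ B|k|`, `B > 0`.
[folklore] -/
private theorem logPlus_sum_le {B : ℝ} (hB : 0 < B) {a b j k : ℝ} (ha : |a| ≤ B * |j|)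
    (hb : |b| ≤ B * |k|) :
    logPlus (|a| + |b|) ≤ Real.log (2 + B) + logPlus j + logPlus k := by
  rw [logPlus_eq, logPlus_eq, logPlus_eq, abs_of_nonneg (by positivity : (0:ℝ) ≤ |a| + |b|),
    ← Real.log_mul (by positivity) (by positivity), ← Real.log_mul (by positivity) (by positivity)]
  refine Real.log_le_log (by positivity) ?_
  nlinarith [abs_nonneg j, abs_nonneg k, mul_nonneg (abs_nonneg j) (abs_nonneg k),
    mul_nonneg hB.le (mul_nonneg (abs_nonneg j) (abs_nonneg k))]

/-! ### A.2 The zero-extended summand `k ↦ ψ_T(k)/(ξ_k − ξ_j)³` and its majorant -/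

/-- Unfolding lemma for `cubeTerm` off the excluded indices.
[cite: RodgersTaoFMP2020, Lemma 18 p. 42 (proof)] -/
private theorem cubeTerm_of_ne {T : ℝ} {j k : ℤ} (hk : k ≠ 0) (hkj : k ≠ j) :
    (if k = 0 ∨ k = j then (0 : ℝ) else truncWeight T k / (classicalLocationZ k - classicalLocationZ j) ^ 3) =
      truncWeight T k / (classicalLocationZ k - classicalLocationZ j) ^ 3 := by
  simp [hk, hkj]

/-- `cubeTerm T j j = 0` and `cubeTerm T j 0 = 0`. [cite: RodgersTaoFMP2020, Lemma 18 p. 42 (proof)] -/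
@[simp] private theorem cubeTerm_self (T : ℝ) (j : ℤ) :
    (if j = 0 ∨ j = j then (0 : ℝ) else truncWeight T j / (classicalLocationZ j - classicalLocationZ j) ^ 3) = 0 := by
  simp

/-- `cubeTerm T j 0 = 0`. [cite: RodgersTaoFMP2020, Lemma 18 p. 42 (proof)] -/
@[simp] private theorem cubeTerm_zero (T : ℝ) (j : ℤ) :
    (if (0 : ℤ) = 0 ∨ (0 : ℤ) = j then (0 : ℝ) else truncWeight T ((0 : ℤ)) / (classicalLocationZ ((0 : ℤ)) - classicalLocationZ j) ^ 3) = 0 := by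
  simp

/-- Oddness under `(j, k) ↦ (−j, −k)`: `g_{−j}(−k) = −g_j(k)` (`ξ_{−k} = −ξ_k`, `ψ_T` even).
[cite: RodgersTaoFMP2020, Lemma 18 p. 42 (proof)] -/
private theorem cubeTerm_neg_neg (T : ℝ) (j k : ℤ) :
    (if -k = 0 ∨ -k = -j then (0 : ℝ) else truncWeight T (-k) / (classicalLocationZ (-k) - classicalLocationZ (-j)) ^ 3) =
      -(if k = 0 ∨ k = j then (0 : ℝ) else truncWeight T k / (classicalLocationZ k - classicalLocationZ j) ^ 3) := by
  by_cases h : k = 0 ∨ k = j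
  · have h' : -k = 0 ∨ -k = -j := by omega
    simp only [h, h', if_true, neg_zero]
  · have h' : ¬(-k = 0 ∨ -k = -j) := by omega
    simp only [h, h', if_false, classicalLocationZ_neg, truncWeight_neg]
    have h3 : (-classicalLocationZ k - -classicalLocationZ j) ^ 3 =
        -((classicalLocationZ k - classicalLocationZ j) ^ 3) := by ring
    rw [h3, div_neg]

/-- The sum over `ℤ* ∖ {j}` as a subtype equals the `ℤ`-sum of the zero extension, with the same
summability. [cite: RodgersTaoFMP2020, Lemma 18 p. 42 (proof)] -/
private theorem tsum_subtype_eq_tsum_cubeTerm (T : ℝ) (j : ℤ) :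
    (Summable (fun k : zstarCompl {j} ↦
        truncWeight T k / (classicalLocationZ k - classicalLocationZ j) ^ 3) ↔
      Summable (fun k : ℤ ↦ if k = 0 ∨ k = j then (0 : ℝ) else truncWeight T k / (classicalLocationZ k - classicalLocationZ j) ^ 3)) ∧
    ∑' k : zstarCompl {j}, truncWeight T k / (classicalLocationZ k - classicalLocationZ j) ^ 3 =
      ∑' k : ℤ, (if k = 0 ∨ k = j then (0 : ℝ) else truncWeight T k / (classicalLocationZ k - classicalLocationZ j) ^ 3) := by
  have hind : (zstarCompl {j}).indicator
      (fun k : ℤ ↦ truncWeight T k / (classicalLocationZ k - classicalLocationZ j) ^ 3) =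
      (fun k : ℤ ↦ if k = 0 ∨ k = j then (0 : ℝ) else truncWeight T k / (classicalLocationZ k - classicalLocationZ j) ^ 3) := by
    ext k
    by_cases h : k = 0 ∨ k = j
    · have hk : k ∉ zstarCompl {j} := by
        simp only [mem_zstarCompl, Finset.mem_singleton, not_and, not_not]; omega
      rw [Set.indicator_of_notMem hk]; simp [h]
    · have hk : k ∈ zstarCompl {j} := by
        simp only [mem_zstarCompl, Finset.mem_singleton]; omega
      rw [Set.indicator_of_mem hk]; simp [h]
  constructor
  · rw [show (fun k : zstarCompl {j} ↦
        truncWeight T k / (classicalLocationZ k - classicalLocationZ j) ^ 3) =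
        (fun k : ℤ ↦ truncWeight T k / (classicalLocationZ k - classicalLocationZ j) ^ 3) ∘
          ((↑) : zstarCompl {j} → ℤ) from rfl, summable_subtype_iff_indicator, hind]
  · have h := tsum_subtype (zstarCompl {j})
      (fun k : ℤ ↦ truncWeight T k / (classicalLocationZ k - classicalLocationZ j) ^ 3)
    rw [hind] at h
    exact h


/-! ### A.3 The majorant `4(Q³ + log₊³ m)/(c³|m|³)` and summability -/

/-- `maj ≥ 0`. [cite: RodgersTaoFMP2020, Lemma 18 p. 42 (proof)] -/
private theorem maj_nonneg {Q c : ℝ} (hQ : 0 ≤ Q) (hc : 0 < c) (m : ℤ) : 0 ≤ (4 * (Q ^ 3 + logPlus m ^ 3) / (c ^ 3 * |(m : ℝ)| ^ 3)) :=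
  div_nonneg (mul_nonneg (by norm_num) (add_nonneg (pow_nonneg hQ 3)
    (pow_nonneg (logPlus_nonneg _) 3))) (by positivity)

/-- `maj(m) ≤ (1/R) · (4Q³/c³ · 1/m² + 4/c³ · log₊³ m/m²)` whenever `R ≤ |m|`, `R > 0`
(from `|m|³ = |m| · m²`). [cite: RodgersTaoFMP2020, Lemma 18 p. 42 (proof)] -/
private theorem maj_le_of_le_abs {Q c R : ℝ} (hQ : 0 ≤ Q) (hc : 0 < c) (hR : 0 < R) {m : ℤ}
    (hm : R ≤ |(m : ℝ)|) :
    (4 * (Q ^ 3 + logPlus m ^ 3) / (c ^ 3 * |(m : ℝ)| ^ 3)) ≤ (1 / R) * ((4 * Q ^ 3 / c ^ 3) * (1 / (m : ℝ) ^ 2) +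
      (4 / c ^ 3) * (logPlus m ^ 3 / (m : ℝ) ^ 2)) := by
  have hm0 : 0 < |(m : ℝ)| := hR.trans_le hm
  have hm2 : 0 < (m : ℝ) ^ 2 := by rw [← sq_abs]; positivity
  have hnum : 0 ≤ 4 * (Q ^ 3 + logPlus m ^ 3) :=
    mul_nonneg (by norm_num) (add_nonneg (pow_nonneg hQ 3) (pow_nonneg (logPlus_nonneg _) 3))
  have h1 : (4 * (Q ^ 3 + logPlus m ^ 3) / (c ^ 3 * |(m : ℝ)| ^ 3)) = 4 * (Q ^ 3 + logPlus m ^ 3) / c ^ 3 * (1 / |(m : ℝ)|) * (1 / (m : ℝ) ^ 2) := by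
    rw [show |(m : ℝ)| ^ 3 = |(m : ℝ)| * (m : ℝ) ^ 2 by rw [← sq_abs]; ring]
    field_simp
  have h2 : (1 / R) * ((4 * Q ^ 3 / c ^ 3) * (1 / (m : ℝ) ^ 2) +
      (4 / c ^ 3) * (logPlus m ^ 3 / (m : ℝ) ^ 2)) =
      4 * (Q ^ 3 + logPlus m ^ 3) / c ^ 3 * (1 / R) * (1 / (m : ℝ) ^ 2) := by
    field_simp
  rw [h1, h2]
  have h3 : 1 / |(m : ℝ)| ≤ 1 / R := one_div_le_one_div_of_le hR hm
  have h4 : 0 ≤ 4 * (Q ^ 3 + logPlus m ^ 3) / c ^ 3 := div_nonneg hnum (by positivity)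
  gcongr

/-- `maj(m) ≤ 4Q³/c³ · 1/m² + 4/c³ · log₊³ m/m²` for all `m` (both sides vanish at `m = 0`).
[cite: RodgersTaoFMP2020, Lemma 18 p. 42 (proof)] -/
private theorem maj_le {Q c : ℝ} (hQ : 0 ≤ Q) (hc : 0 < c) (m : ℤ) :
    (4 * (Q ^ 3 + logPlus m ^ 3) / (c ^ 3 * |(m : ℝ)| ^ 3)) ≤ (4 * Q ^ 3 / c ^ 3) * (1 / (m : ℝ) ^ 2) +
      (4 / c ^ 3) * (logPlus m ^ 3 / (m : ℝ) ^ 2) := by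
  rcases eq_or_ne m 0 with rfl | hm
  · simp
  · have hm1 : (1 : ℝ) ≤ |(m : ℝ)| := by
      rw [← Int.cast_abs]; exact_mod_cast Int.one_le_abs hm
    have := maj_le_of_le_abs hQ hc one_pos hm1
    simpa using this

/-- `maj` is summable over `ℤ`. [cite: RodgersTaoFMP2020, Lemma 18 p. 42 (proof)] -/
private theorem summable_maj {Q c : ℝ} (hQ : 0 ≤ Q) (hc : 0 < c) : Summable (fun m : ℤ ↦ 4 * (Q ^ 3 + logPlus m ^ 3) / (c ^ 3 * |(m : ℝ)| ^ 3)) :=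
  Summable.of_nonneg_of_le (maj_nonneg hQ hc) (maj_le hQ hc)
    ((summable_one_div_sq.mul_left _).add (summable_logPlus_cube_div_sq.mul_left _))

/-- The full sum of the upper bound: `Σ_m (4Q³/c³ · 1/m² + 4/c³ · log₊³ m/m²) ≤ 4Q³/c³ · 4 + 4S₃/c³`,
`S₃ := Σ_m log₊³ m/m²`. [cite: RodgersTaoFMP2020, Lemma 18 p. 42 (proof)] -/
theorem tsum_majBound_le {Q c : ℝ} (hQ : 0 ≤ Q) (hc : 0 < c) :
    ∑' m : ℤ, ((4 * Q ^ 3 / c ^ 3) * (1 / (m : ℝ) ^ 2) +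
      (4 / c ^ 3) * (logPlus m ^ 3 / (m : ℝ) ^ 2)) ≤
      (4 * Q ^ 3 / c ^ 3) * 4 + (4 / c ^ 3) * ∑' m : ℤ, logPlus m ^ 3 / (m : ℝ) ^ 2 := by
  have hZ := (summable_one_div_sq.hasSum.mul_left (4 * Q ^ 3 / c ^ 3))
  have hS := (summable_logPlus_cube_div_sq.hasSum.mul_left (4 / c ^ 3))
  rw [(hZ.add hS).tsum_eq]
  have h1 := tsum_one_div_sq_le
  have h2 : 0 ≤ 4 * Q ^ 3 / c ^ 3 := by positivity
  have h3 := mul_le_mul_of_nonneg_left h1 h2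
  linarith

/-- Termwise domination of the shifted summand by the majorant: for `j ∈ ℤ*` and `T log T > 0`,
`|g_j(j + m)| ≤ maj_{Q_j}(m)` with `Q_j := log(2 + B) + 2 log₊ j` (`B`, `c` the constants of
(43)–(44)): from `|ξ_k − ξ_j| ≥ c|k − j|/log₊(|ξ_j| + |ξ_k|)`, `ψ_T ≤ 1` and
`log₊(|ξ_j| + |ξ_k|) ≤ log(2 + B) + 2 log₊ j + log₊(k − j)`.
[cite: RodgersTaoFMP2020, Lemma 18 p. 42 (proof, «from (44) … the contribution … is acceptable»)] -/
private theorem abs_cubeTerm_shift_le_maj {c C B : ℝ} (hc : 0 < c) (hB : 0 < B)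
    (h44 : ∀ j k : ℤ, j ≠ 0 → k ≠ 0 →
      c * (|(k : ℝ) - j| / logPlus (|classicalLocationZ j| + |classicalLocationZ k|)) ≤
          |classicalLocationZ k - classicalLocationZ j| ∧
        |classicalLocationZ k - classicalLocationZ j| ≤
          C * (|(k : ℝ) - j| / logPlus (|classicalLocationZ j| + |classicalLocationZ k|)))
    (h43 : ∀ k : ℤ, |classicalLocationZ k| ≤ B * |(k : ℝ)|)
    {T : ℝ} (hT : 0 < T * Real.log T) {j : ℤ} (hj : j ≠ 0) {Q : ℝ}
    (hQj : Real.log (2 + B) + 2 * logPlus j ≤ Q) (m : ℤ) :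
    |(if j + m = 0 ∨ j + m = j then (0 : ℝ) else truncWeight T (j + m) / (classicalLocationZ (j + m) - classicalLocationZ j) ^ 3)| ≤
      (4 * (Q ^ 3 + logPlus m ^ 3) / (c ^ 3 * |(m : ℝ)| ^ 3)) := by
  have hQ : 0 ≤ Q := le_trans
    (add_nonneg (Real.log_nonneg (by linarith)) (mul_nonneg zero_le_two (logPlus_nonneg _))) hQj
  by_cases hk' : j + m = 0 ∨ j + m = j
  · simp only [hk', if_true, abs_zero]
    exact maj_nonneg hQ hc m
  have hk : j + m ≠ 0 ∧ j + m ≠ j := ⟨fun h ↦ hk' (Or.inl h), fun h ↦ hk' (Or.inr h)⟩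
  have hm0 : m ≠ 0 := fun h ↦ hk.2 (by rw [h, add_zero])
  rw [cubeTerm_of_ne hk.1 hk.2]
  -- the (44) lower bound
  set Lp := logPlus (|classicalLocationZ j| + |classicalLocationZ (j + m)|) with hLp
  have hLp0 : 0 < Lp := logPlus_pos _
  have hlow := (h44 j (j + m) hj hk.1).1
  have hcast : |((j + m : ℤ) : ℝ) - j| = |(m : ℝ)| := by push_cast; ring_nf
  rw [hcast] at hlow
  have hmabs : 0 < |(m : ℝ)| := by
    have : (1 : ℝ) ≤ |(m : ℝ)| := by rw [← Int.cast_abs]; exact_mod_cast Int.one_le_abs hm0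
    linarith
  have hδ : 0 < c * (|(m : ℝ)| / Lp) := by positivity
  have hd0 : 0 < |classicalLocationZ (j + m) - classicalLocationZ j| := hδ.trans_le hlow
  -- `log₊(|ξ_j| + |ξ_k|) ≤ Q + log₊ m`
  have hLpQ : Lp ≤ Q + logPlus m := by
    have h1 := logPlus_sum_le hB (h43 j) (h43 (j + m))
    have h2 : logPlus (((j + m : ℤ) : ℝ)) ≤ logPlus (j : ℝ) + logPlus (m : ℝ) := by
      have := logPlus_le_logPlus_add_logPlus_sub (j : ℝ) (((j + m : ℤ) : ℝ))
      have h3 : (((j + m : ℤ) : ℝ)) - (j : ℝ) = (m : ℝ) := by push_cast; ring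
      rwa [h3] at this
    linarith
  -- `|ψ/(d)³| ≤ 1/|d|³ ≤ (Lp/(c|m|))³ ≤ ((Q + log₊ m)/(c|m|))³ ≤ maj`
  have hψ0 := (truncWeight_pos hT (j + m)).le
  have hψ1 := truncWeight_le_one hT (j + m)
  rw [abs_div, abs_of_nonneg hψ0, abs_pow]
  have h1 : truncWeight T (j + m) / |classicalLocationZ (j + m) - classicalLocationZ j| ^ 3 ≤
      1 / (c * (|(m : ℝ)| / Lp)) ^ 3 := by
    have hp : (c * (|(m : ℝ)| / Lp)) ^ 3 ≤ |classicalLocationZ (j + m) - classicalLocationZ j| ^ 3 :=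
      pow_le_pow_left₀ hδ.le hlow 3
    calc truncWeight T (j + m) / |classicalLocationZ (j + m) - classicalLocationZ j| ^ 3
        ≤ 1 / |classicalLocationZ (j + m) - classicalLocationZ j| ^ 3 :=
          div_le_div_of_nonneg_right hψ1 (by positivity)
      _ ≤ 1 / (c * (|(m : ℝ)| / Lp)) ^ 3 := one_div_le_one_div_of_le (by positivity) hp
  have h2 : 1 / (c * (|(m : ℝ)| / Lp)) ^ 3 = Lp ^ 3 / (c ^ 3 * |(m : ℝ)| ^ 3) := by
    field_simp
  have h3 : Lp ^ 3 ≤ 4 * (Q ^ 3 + logPlus m ^ 3) :=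
    (pow_le_pow_left₀ hLp0.le hLpQ 3).trans (add_pow_three_le hQ (logPlus_nonneg _))
  calc truncWeight T (j + m) / |classicalLocationZ (j + m) - classicalLocationZ j| ^ 3
      ≤ Lp ^ 3 / (c ^ 3 * |(m : ℝ)| ^ 3) := h1.trans_eq h2
    _ ≤ 4 * (Q ^ 3 + logPlus m ^ 3) / (c ^ 3 * |(m : ℝ)| ^ 3) :=
        div_le_div_of_nonneg_right h3 (by positivity)

/-- Summability of `k ↦ g_j(k)` on `ℤ` for `j ∈ ℤ*`, `T log T > 0`.
[cite: RodgersTaoFMP2020, Lemma 18 p. 42 (proof)] -/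
private theorem summable_cubeTerm {c C B : ℝ} (hc : 0 < c) (hB : 0 < B)
    (h44 : ∀ j k : ℤ, j ≠ 0 → k ≠ 0 →
      c * (|(k : ℝ) - j| / logPlus (|classicalLocationZ j| + |classicalLocationZ k|)) ≤
          |classicalLocationZ k - classicalLocationZ j| ∧
        |classicalLocationZ k - classicalLocationZ j| ≤
          C * (|(k : ℝ) - j| / logPlus (|classicalLocationZ j| + |classicalLocationZ k|)))
    (h43 : ∀ k : ℤ, |classicalLocationZ k| ≤ B * |(k : ℝ)|)
    {T : ℝ} (hT : 0 < T * Real.log T) {j : ℤ} (hj : j ≠ 0) :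
    Summable (fun m : ℤ ↦ (if j + m = 0 ∨ j + m = j then (0 : ℝ) else truncWeight T (j + m) / (classicalLocationZ (j + m) - classicalLocationZ j) ^ 3)) ∧
      Summable (fun k : ℤ ↦ if k = 0 ∨ k = j then (0 : ℝ) else truncWeight T k / (classicalLocationZ k - classicalLocationZ j) ^ 3) := by
  have hQ : 0 ≤ Real.log (2 + B) + 2 * logPlus j :=
    add_nonneg (Real.log_nonneg (by linarith)) (mul_nonneg zero_le_two (logPlus_nonneg _))
  have hs : Summable (fun m : ℤ ↦ (if j + m = 0 ∨ j + m = j then (0 : ℝ) else truncWeight T (j + m) / (classicalLocationZ (j + m) - classicalLocationZ j) ^ 3)) :=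
    Summable.of_norm_bounded (summable_maj hQ hc) fun m ↦ by
      rw [Real.norm_eq_abs]; exact abs_cubeTerm_shift_le_maj hc hB h44 h43 hT hj le_rfl m
  refine ⟨hs, ?_⟩
  have : (fun m : ℤ ↦ (if j + m = 0 ∨ j + m = j then (0 : ℝ) else truncWeight T (j + m) / (classicalLocationZ (j + m) - classicalLocationZ j) ^ 3)) =
      (fun k : ℤ ↦ if k = 0 ∨ k = j then (0 : ℝ) else truncWeight T k / (classicalLocationZ k - classicalLocationZ j) ^ 3) ∘ (Equiv.addLeft j) := by
    ext m; simp
  rw [this] at hs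
  exact (Equiv.summable_iff _).1 hs


/-! ### A.4 The far tail, the symmetrised near pairs -/

/-- The far tail: if `|h m| ≤ maj_Q(m)` for all `m`, then the sum of `h` over `|m| > M` is at most
`(1/(M+1)) · (4Q³/c³ · 4 + 4/c³ · S₃)` («the contribution of those `k` with `|k − j| ≥ j/2` is
acceptable», p. 42). [cite: RodgersTaoFMP2020, Lemma 18 p. 42 (proof)] -/
private theorem abs_tsum_compl_le {Q c : ℝ} (hQ : 0 ≤ Q) (hc : 0 < c) {h : ℤ → ℝ}
    (hh : ∀ m, |h m| ≤ (4 * (Q ^ 3 + logPlus m ^ 3) / (c ^ 3 * |(m : ℝ)| ^ 3))) (M : ℕ) :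
    |(∑' m : (((Finset.Icc (-(M : ℤ)) M : Finset ℤ) : Set ℤ)ᶜ : Set ℤ), h m)| ≤
      (1 / ((M : ℝ) + 1)) * ((4 * Q ^ 3 / c ^ 3) * 4 +
        (4 / c ^ 3) * ∑' m : ℤ, logPlus m ^ 3 / (m : ℝ) ^ 2) := by
  set s : Set ℤ := (((Finset.Icc (-(M : ℤ)) M : Finset ℤ) : Set ℤ)ᶜ : Set ℤ) with hs
  set bnd : ℤ → ℝ := fun m ↦ (4 * Q ^ 3 / c ^ 3) * (1 / (m : ℝ) ^ 2) +
      (4 / c ^ 3) * (logPlus m ^ 3 / (m : ℝ) ^ 2) with hbnd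
  have hbnd0 : ∀ m, 0 ≤ bnd m := fun m ↦ by
    simp only [hbnd]
    exact add_nonneg (by positivity) (mul_nonneg (by positivity)
      (div_nonneg (pow_nonneg (logPlus_nonneg _) 3) (sq_nonneg _)))
  have hbndS : Summable bnd :=
    (summable_one_div_sq.mul_left _).add (summable_logPlus_cube_div_sq.mul_left _)
  have hM1 : (0 : ℝ) < (M : ℝ) + 1 := by positivity
  have hmem : ∀ m : s, (M : ℝ) + 1 ≤ |((m : ℤ) : ℝ)| := by
    rintro ⟨m, hm⟩
    simp only [hs, Set.mem_compl_iff, Finset.coe_Icc, Set.mem_Icc, not_and_or, not_le] at hm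
    rw [← Int.cast_abs]
    have : (M : ℤ) + 1 ≤ |m| := by
      rcases hm with hm | hm
      · rw [abs_of_neg (by omega)]; omega
      · rw [abs_of_pos (by omega)]; omega
    exact_mod_cast this
  have hmajS : Summable (fun m : s ↦ (4 * (Q ^ 3 + logPlus m ^ 3) / (c ^ 3 * |(m : ℝ)| ^ 3))) := (summable_maj hQ hc).subtype _
  have habsS : Summable (fun m : s ↦ |h m|) :=
    Summable.of_nonneg_of_le (fun m ↦ abs_nonneg _) (fun m ↦ hh m) hmajS
  have hbndS' : Summable (fun m : s ↦ (1 / ((M : ℝ) + 1)) * bnd m) :=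
    (hbndS.subtype _).mul_left _
  have h1 : |∑' m : s, h m| ≤ ∑' m : s, |h m| := by
    have := norm_tsum_le_tsum_norm (f := fun m : s ↦ h m) (by simpa using habsS)
    simpa using this
  have h2 : ∑' m : s, |h m| ≤ ∑' m : s, (1 / ((M : ℝ) + 1)) * bnd m :=
    habsS.tsum_le_tsum (fun m ↦ (hh m).trans (maj_le_of_le_abs hQ hc hM1 (hmem m))) hbndS'
  have h3 : ∑' m : s, (1 / ((M : ℝ) + 1)) * bnd m = (1 / ((M : ℝ) + 1)) * ∑' m : s, bnd m :=
    tsum_mul_left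
  have h4 : ∑' m : s, bnd m ≤ ∑' m : ℤ, bnd m := hbndS.tsum_subtype_le bnd s hbnd0
  have h5 : ∑' m : ℤ, bnd m ≤ (4 * Q ^ 3 / c ^ 3) * 4 +
      (4 / c ^ 3) * ∑' m : ℤ, logPlus m ^ 3 / (m : ℝ) ^ 2 := tsum_majBound_le hQ hc
  calc |∑' m : s, h m| ≤ ∑' m : s, |h m| := h1
    _ ≤ (1 / ((M : ℝ) + 1)) * ∑' m : s, bnd m := h2.trans_eq h3
    _ ≤ (1 / ((M : ℝ) + 1)) * ((4 * Q ^ 3 / c ^ 3) * 4 +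
        (4 / c ^ 3) * ∑' m : ℤ, logPlus m ^ 3 / (m : ℝ) ^ 2) :=
        mul_le_mul_of_nonneg_left (h4.trans h5) (by positivity)

/-- Symmetrisation of a finite sum over `[−M, M] ⊂ ℤ`:
`Σ_{|m| ≤ M} h(m) = h(0) + Σ_{n=1}^{M} (h(n) + h(−n))`. [folklore] -/
private theorem sum_Icc_neg_eq (h : ℤ → ℝ) (M : ℕ) :
    ∑ m ∈ Finset.Icc (-(M : ℤ)) M, h m =
      h 0 + ∑ n ∈ Finset.Icc 1 M, (h (n : ℤ) + h (-(n : ℤ))) := by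
  induction M with
  | zero => simp
  | succ M ih =>
    have h1 : Finset.Icc (-((M + 1 : ℕ) : ℤ)) ((M + 1 : ℕ) : ℤ) =
        insert (((M + 1 : ℕ) : ℤ)) (insert (-((M + 1 : ℕ) : ℤ)) (Finset.Icc (-(M : ℤ)) M)) := by
      ext x; simp only [Finset.mem_Icc, Finset.mem_insert]; push_cast; omega
    have h2 : ((M + 1 : ℕ) : ℤ) ∉ insert (-((M + 1 : ℕ) : ℤ)) (Finset.Icc (-(M : ℤ)) M) := by
      simp only [Finset.mem_insert, Finset.mem_Icc]; push_cast; omega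
    have h3 : -((M + 1 : ℕ) : ℤ) ∉ Finset.Icc (-(M : ℤ)) (M : ℤ) := by
      simp only [Finset.mem_Icc]; push_cast; omega
    rw [h1, Finset.sum_insert h2, Finset.sum_insert h3, ih, Finset.sum_Icc_succ_top (by omega)]
    ring

/-- `Σ_{n=1}^{M} 1/n² ≤ 2`. [folklore] -/
private theorem sum_Icc_one_div_sq_le (M : ℕ) :
    ∑ n ∈ Finset.Icc 1 M, 1 / ((n : ℕ) : ℝ) ^ 2 ≤ 2 := by
  have h := sum_Ioo_inv_sq_le (α := ℝ) 0 (M + 1)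
  have h1 : Finset.Ioo 0 (M + 1) = Finset.Icc 1 M := by
    ext i; simp only [Finset.mem_Ioo, Finset.mem_Icc]; omega
  rw [h1] at h
  norm_num at h
  simpa [one_div] using h

/-- The symmetrised near pair (pure inequality): with `c m/P ≤ d_± ≤ C_u m/Q_d`,
`|d_+ − d_−| ≤ 2A m²/j`, `|ψ_± − ψ_j| ≤ 100 m/N` and `0 ≤ ψ_j ≤ 1`,
`|ψ_+/d_+³ − ψ_−/d_−³| ≤ 6 A C_u² P⁶/(c⁶ Q_d²) · 1/(j m²) + 200 P³/(c³ N m²)`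
(«direct computation using the fact that `k ↦ 1/(k − j)` is odd around `j`», p. 43: the main
terms cancel in pairs, (45) controls the second difference of `ξ`, and `ψ_T` is Lipschitz).
[cite: RodgersTaoFMP2020, Lemma 18 pp. 42–43 (proof)] -/
theorem abs_pair_le {ψj ψp ψm dp dm m N P Cu Qd c A j : ℝ}
    (hm : 1 ≤ m) (hj : 0 < j) (hN : 0 < N) (hc : 0 < c) (hP : 0 < P) (hQd : 0 < Qd)
    (hCu : 0 ≤ Cu) (hA : 0 ≤ A)
    (hψp : |ψp - ψj| ≤ 100 * m / N) (hψm : |ψm - ψj| ≤ 100 * m / N)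
    (hψj0 : 0 ≤ ψj) (hψj1 : ψj ≤ 1)
    (hdp : c * m / P ≤ dp) (hdm : c * m / P ≤ dm) (hdpU : dp ≤ Cu * m / Qd)
    (hdmU : dm ≤ Cu * m / Qd) (hdiff : |dp - dm| ≤ 2 * A * m ^ 2 / j) :
    |ψp / dp ^ 3 - ψm / dm ^ 3| ≤
      6 * A * Cu ^ 2 * P ^ 6 / (c ^ 6 * Qd ^ 2) * (1 / (j * m ^ 2)) +
        200 * P ^ 3 / (c ^ 3 * N) * (1 / m ^ 2) := by
  have hm0 : 0 < m := by linarith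
  set L : ℝ := c * m / P with hL
  have hL0 : 0 < L := by positivity
  have hdp0 : 0 < dp := hL0.trans_le hdp
  have hdm0 : 0 < dm := hL0.trans_le hdm
  set U : ℝ := Cu * m / Qd with hU
  have hU0 : 0 ≤ U := by positivity
  -- decomposition
  have hdec : ψp / dp ^ 3 - ψm / dm ^ 3 =
      ψj * (1 / dp ^ 3 - 1 / dm ^ 3) + (ψp - ψj) / dp ^ 3 - (ψm - ψj) / dm ^ 3 := by
    field_simp
    ring
  -- the cube difference
  have hcube : |1 / dp ^ 3 - 1 / dm ^ 3| ≤ 2 * A * m ^ 2 / j * (3 * U ^ 2) / L ^ 6 := by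
    have he : 1 / dp ^ 3 - 1 / dm ^ 3 = (dm - dp) * (dm ^ 2 + dm * dp + dp ^ 2) / (dp ^ 3 * dm ^ 3) := by
      field_simp
      ring
    rw [he, abs_div, abs_mul, abs_of_pos (by positivity : 0 < dp ^ 3 * dm ^ 3),
      abs_of_nonneg (by positivity : 0 ≤ dm ^ 2 + dm * dp + dp ^ 2), abs_sub_comm]
    have h1 : dm ^ 2 + dm * dp + dp ^ 2 ≤ 3 * U ^ 2 := by
      nlinarith [mul_le_mul hdpU hdpU hdp0.le hU0, mul_le_mul hdmU hdmU hdm0.le hU0,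
        mul_le_mul hdmU hdpU hdp0.le hU0]
    have h2 : L ^ 6 ≤ dp ^ 3 * dm ^ 3 := by
      have h3 : L ^ 3 ≤ dp ^ 3 := pow_le_pow_left₀ hL0.le hdp 3
      have h4 : L ^ 3 ≤ dm ^ 3 := pow_le_pow_left₀ hL0.le hdm 3
      calc L ^ 6 = L ^ 3 * L ^ 3 := by ring
        _ ≤ dp ^ 3 * dm ^ 3 := mul_le_mul h3 h4 (by positivity) (by positivity)
    have h5 : |dp - dm| * (dm ^ 2 + dm * dp + dp ^ 2) ≤ 2 * A * m ^ 2 / j * (3 * U ^ 2) :=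
      mul_le_mul hdiff h1 (by positivity) (by positivity)
    exact div_le_div₀ (by positivity) h5 (by positivity) h2
  have hcube' : 2 * A * m ^ 2 / j * (3 * U ^ 2) / L ^ 6 =
      6 * A * Cu ^ 2 * P ^ 6 / (c ^ 6 * Qd ^ 2) * (1 / (j * m ^ 2)) := by
    simp only [hL, hU]
    field_simp
    ring
  -- the Lipschitz terms
  have hlip : ∀ {ψ d : ℝ}, |ψ - ψj| ≤ 100 * m / N → L ≤ d →
      |(ψ - ψj) / d ^ 3| ≤ 100 * P ^ 3 / (c ^ 3 * N) * (1 / m ^ 2) := by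
    intro ψ d hψ hd
    have hd0 : 0 < d := hL0.trans_le hd
    rw [abs_div, abs_of_pos (by positivity : 0 < d ^ 3)]
    have h1 : L ^ 3 ≤ d ^ 3 := pow_le_pow_left₀ hL0.le hd 3
    have h2 : |ψ - ψj| / d ^ 3 ≤ (100 * m / N) / L ^ 3 :=
      div_le_div₀ (by positivity) hψ (by positivity) h1
    have h3 : (100 * m / N) / L ^ 3 = 100 * P ^ 3 / (c ^ 3 * N) * (1 / m ^ 2) := by
      simp only [hL]
      field_simp
    exact h2.trans_eq h3
  have hA1 : |ψj * (1 / dp ^ 3 - 1 / dm ^ 3)| ≤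
      6 * A * Cu ^ 2 * P ^ 6 / (c ^ 6 * Qd ^ 2) * (1 / (j * m ^ 2)) := by
    rw [abs_mul, abs_of_nonneg hψj0]
    calc ψj * |1 / dp ^ 3 - 1 / dm ^ 3| ≤ 1 * |1 / dp ^ 3 - 1 / dm ^ 3| :=
          mul_le_mul_of_nonneg_right hψj1 (abs_nonneg _)
      _ ≤ 6 * A * Cu ^ 2 * P ^ 6 / (c ^ 6 * Qd ^ 2) * (1 / (j * m ^ 2)) := by
          rw [one_mul]; exact hcube.trans_eq hcube'
  have hA2 := hlip hψp hdp
  have hA3 := hlip hψm hdm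
  rw [hdec]
  calc |ψj * (1 / dp ^ 3 - 1 / dm ^ 3) + (ψp - ψj) / dp ^ 3 - (ψm - ψj) / dm ^ 3|
      ≤ |ψj * (1 / dp ^ 3 - 1 / dm ^ 3)| + |(ψp - ψj) / dp ^ 3| + |(ψm - ψj) / dm ^ 3| := by
        have e1 := abs_add_le (ψj * (1 / dp ^ 3 - 1 / dm ^ 3)) ((ψp - ψj) / dp ^ 3)
        have e2 := abs_sub (ψj * (1 / dp ^ 3 - 1 / dm ^ 3) + (ψp - ψj) / dp ^ 3)
          ((ψm - ψj) / dm ^ 3)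
        linarith
    _ ≤ 6 * A * Cu ^ 2 * P ^ 6 / (c ^ 6 * Qd ^ 2) * (1 / (j * m ^ 2)) +
        100 * P ^ 3 / (c ^ 3 * N) * (1 / m ^ 2) + 100 * P ^ 3 / (c ^ 3 * N) * (1 / m ^ 2) := by
        linarith
    _ = 6 * A * Cu ^ 2 * P ^ 6 / (c ^ 6 * Qd ^ 2) * (1 / (j * m ^ 2)) +
        200 * P ^ 3 / (c ^ 3 * N) * (1 / m ^ 2) := by ring


/-! ### A.5 The near pairs over the classical locations and the `p. 42` display for `j ≥ 1` -/

/-- The near pair `k = j ± n` (`1 ≤ n ≤ j/2`, `j ≥ 1`, `T ≥ 3`):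
`|g_j(j+n) + g_j(j−n)| ≤ 6AC²P⁶/(c⁶(c₈ log₊ j)²) · 1/(j n²) + 200P³/(c³ T log T) · 1/n²` with
`P = log(2 + B) + 3 log₊ j` — from (44) (size of `ξ_{j±n} − ξ_j`), the corrected (45) applied at
`k = j + n` and `k = j − n` (second difference `≤ 2A n²/j`), and the Lipschitz bound for `ψ_T`.
[cite: RodgersTaoFMP2020, Lemma 18 pp. 42–43 (proof, near range `|k − j| < j/2`)] -/
private theorem abs_near_pair_le {c C B c₈ C₈ A : ℝ} (hc : 0 < c) (hcC : c ≤ C) (hB : 0 < B)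
    (hc₈ : 0 < c₈) (hA : 0 ≤ A)
    (h44 : ∀ j k : ℤ, j ≠ 0 → k ≠ 0 →
      c * (|(k : ℝ) - j| / logPlus (|classicalLocationZ j| + |classicalLocationZ k|)) ≤
          |classicalLocationZ k - classicalLocationZ j| ∧
        |classicalLocationZ k - classicalLocationZ j| ≤
          C * (|(k : ℝ) - j| / logPlus (|classicalLocationZ j| + |classicalLocationZ k|)))
    (h43 : ∀ k : ℤ, |classicalLocationZ k| ≤ B * |(k : ℝ)|)
    (h8 : ∀ y : ℝ, 1 ≤ y → c₈ * logPlus y ≤ logPlus (classicalLocation y) ∧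
      logPlus (classicalLocation y) ≤ C₈ * logPlus y)
    (h45 : ∀ j k : ℝ, 1 ≤ j → 1 ≤ k → j ≤ 2 * k → k ≤ 2 * j →
      |classicalLocation k - classicalLocation j -
          4 * π * (k - j) / Real.log (classicalLocation j / (4 * π))| ≤
        A * ((k - j) ^ 2 / (j * Real.log (classicalLocation j) ^ 2)))
    {T : ℝ} (hT : 3 ≤ T) {j : ℤ} (hj : 1 ≤ j) {n : ℕ} (hn1 : 1 ≤ n) (hnj : 2 * (n : ℤ) ≤ j) :
    |(if j + n = 0 ∨ j + n = j then (0 : ℝ) else truncWeight T (j + n) / (classicalLocationZ (j + n) - classicalLocationZ j) ^ 3) +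
      (if j + -(n : ℤ) = 0 ∨ j + -(n : ℤ) = j then (0 : ℝ) else truncWeight T (j + -(n : ℤ)) / (classicalLocationZ (j + -(n : ℤ)) - classicalLocationZ j) ^ 3)| ≤
      6 * A * C ^ 2 * (Real.log (2 + B) + 3 * logPlus j) ^ 6 / (c ^ 6 * (c₈ * logPlus j) ^ 2) *
          (1 / ((j : ℝ) * (n : ℝ) ^ 2)) +
        200 * (Real.log (2 + B) + 3 * logPlus j) ^ 3 / (c ^ 3 * (T * Real.log T)) *
          (1 / (n : ℝ) ^ 2) := by
  obtain ⟨hlogT, hN3, -⟩ := basic_T hT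
  set N := T * Real.log T with hN
  have hN0 : 0 < N := by linarith
  have hC0 : 0 ≤ C := hc.le.trans hcC
  set Lj := logPlus (j : ℝ) with hLj
  have hLj0 : 0 < Lj := logPlus_pos _
  set D₀ := Real.log (2 + B) with hD₀
  have hD₀0 : 0 ≤ D₀ := Real.log_nonneg (by linarith)
  set P : ℝ := D₀ + 3 * Lj with hP
  have hP0 : 0 < P := by positivity
  -- the indices
  have hnr1 : (1 : ℝ) ≤ (n : ℝ) := by exact_mod_cast hn1
  have hnr0 : (0 : ℝ) < (n : ℝ) := by linarith
  have hjr : (1 : ℝ) ≤ (j : ℝ) := by exact_mod_cast hj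
  have hjr0 : (0 : ℝ) < (j : ℝ) := by linarith
  have hnjr : 2 * (n : ℝ) ≤ (j : ℝ) := by exact_mod_cast hnj
  have hkp0 : (0 : ℤ) < j + n := by omega
  have hkm0 : (0 : ℤ) < j + -(n : ℤ) := by omega
  have hkpj : j + (n : ℤ) ≠ j := by omega
  have hkmj : j + -(n : ℤ) ≠ j := by omega
  have hj0 : (0 : ℤ) < j := by omega
  rw [cubeTerm_of_ne hkp0.ne' hkpj, cubeTerm_of_ne hkm0.ne' hkmj]
  -- the classical locations as real-indexed values
  have hξj : classicalLocationZ j = classicalLocation (j : ℝ) := classicalLocationZ_of_pos hj0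
  have hξp : classicalLocationZ (j + n) = classicalLocation ((j : ℝ) + n) := by
    rw [classicalLocationZ_of_pos hkp0]; push_cast; ring_nf
  have hξm : classicalLocationZ (j + -(n : ℤ)) = classicalLocation ((j : ℝ) - n) := by
    rw [classicalLocationZ_of_pos hkm0]; push_cast; ring_nf
  set dp : ℝ := classicalLocationZ (j + n) - classicalLocationZ j with hdp
  set dm : ℝ := classicalLocationZ j - classicalLocationZ (j + -(n : ℤ)) with hdm
  have hdp_pos : 0 < dp := sub_pos.2 (strictMono_classicalLocationZ (by omega))
  have hdm_pos : 0 < dm := sub_pos.2 (strictMono_classicalLocationZ (by omega))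
  -- rewrite the pair as `ψ₊/dp³ − ψ₋/dm³`
  have hrw : truncWeight T (j + n) / (classicalLocationZ (j + n) - classicalLocationZ j) ^ 3 +
      truncWeight T (j + -(n : ℤ)) / (classicalLocationZ (j + -(n : ℤ)) - classicalLocationZ j) ^ 3 =
      truncWeight T (j + n) / dp ^ 3 - truncWeight T (j + -(n : ℤ)) / dm ^ 3 := by
    have : (classicalLocationZ (j + -(n : ℤ)) - classicalLocationZ j) ^ 3 = -dm ^ 3 := by
      rw [hdm]; ring
    rw [this, div_neg]; ring
  rw [hrw]
  -- log₊ bounds: `log₊(|ξ_j| + |ξ_k|) ≤ P` for `k = j ± n`, and `≥ c₈ log₊ j`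
  have hLn : logPlus (n : ℝ) ≤ Lj := logPlus_mono (by
    rw [abs_of_nonneg hnr0.le, abs_of_nonneg hjr0.le]; linarith)
  have hLsum_p : logPlus (|classicalLocationZ j| + |classicalLocationZ (j + n)|) ≤ P := by
    have h1 := logPlus_sum_le hB (h43 j) (h43 (j + n))
    have h2 : logPlus (((j + n : ℤ) : ℝ)) ≤ Lj + logPlus (n : ℝ) := by
      have := logPlus_le_logPlus_add_logPlus_sub (j : ℝ) (((j + n : ℤ) : ℝ))
      have h3 : (((j + n : ℤ) : ℝ)) - (j : ℝ) = (n : ℝ) := by push_cast; ring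
      rwa [h3] at this
    rw [hP]; linarith
  have hLsum_m : logPlus (|classicalLocationZ j| + |classicalLocationZ (j + -(n : ℤ))|) ≤ P := by
    have h1 := logPlus_sum_le hB (h43 j) (h43 (j + -(n : ℤ)))
    have h2 : logPlus (((j + -(n : ℤ) : ℤ) : ℝ)) ≤ Lj + logPlus (n : ℝ) := by
      have := logPlus_le_logPlus_add_logPlus_sub (j : ℝ) (((j + -(n : ℤ) : ℤ) : ℝ))
      have h3 : (((j + -(n : ℤ) : ℤ) : ℝ)) - (j : ℝ) = -(n : ℝ) := by push_cast; ring
      rwa [h3, logPlus_neg] at this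
    rw [hP]; linarith
  have hLlow : ∀ k : ℤ, c₈ * Lj ≤ logPlus (|classicalLocationZ j| + |classicalLocationZ k|) := by
    intro k
    have h1 : c₈ * Lj ≤ logPlus (classicalLocation (j : ℝ)) := (h8 (j : ℝ) hjr).1
    have hpos : 0 < classicalLocation (j : ℝ) := classicalLocation_pos (by linarith)
    have h2 : logPlus (classicalLocation (j : ℝ)) ≤
        logPlus (|classicalLocationZ j| + |classicalLocationZ k|) := by
      apply logPlus_mono
      have e : |(|classicalLocationZ j| + |classicalLocationZ k|)| =
          |classicalLocationZ j| + |classicalLocationZ k| := abs_of_nonneg (by positivity)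
      rw [e, hξj, abs_of_pos hpos]
      linarith [abs_nonneg (classicalLocationZ k)]
    linarith
  have hc₈L : 0 < c₈ * Lj := by positivity
  -- (44) at k = j + n and k = j − n
  have h44p := h44 j (j + n) hj0.ne' hkp0.ne'
  have h44m := h44 j (j + -(n : ℤ)) hj0.ne' hkm0.ne'
  have hcastp : |((j + n : ℤ) : ℝ) - j| = (n : ℝ) := by
    push_cast; rw [show (j : ℝ) + n - j = n by ring, abs_of_nonneg hnr0.le]
  have hcastm : |((j + -(n : ℤ) : ℤ) : ℝ) - j| = (n : ℝ) := by
    push_cast; rw [show (j : ℝ) + -(n : ℝ) - j = -n by ring, abs_neg, abs_of_nonneg hnr0.le]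
  rw [hcastp] at h44p
  rw [hcastm] at h44m
  have habsp : |classicalLocationZ (j + n) - classicalLocationZ j| = dp := abs_of_pos hdp_pos
  have habsm : |classicalLocationZ (j + -(n : ℤ)) - classicalLocationZ j| = dm := by
    rw [abs_sub_comm]; exact abs_of_pos hdm_pos
  rw [habsp] at h44p
  rw [habsm] at h44m
  have hdp_low : c * n / P ≤ dp := by
    refine le_trans ?_ h44p.1
    rw [mul_div_assoc]
    exact mul_le_mul_of_nonneg_left (div_le_div_of_nonneg_left hnr0.le (logPlus_pos _) hLsum_p) hc.le
  have hdm_low : c * n / P ≤ dm := by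
    refine le_trans ?_ h44m.1
    rw [mul_div_assoc]
    exact mul_le_mul_of_nonneg_left (div_le_div_of_nonneg_left hnr0.le (logPlus_pos _) hLsum_m) hc.le
  have hdp_up : dp ≤ C * n / (c₈ * Lj) := by
    refine h44p.2.trans ?_
    rw [mul_div_assoc]
    exact mul_le_mul_of_nonneg_left (div_le_div_of_nonneg_left hnr0.le hc₈L (hLlow _)) hC0
  have hdm_up : dm ≤ C * n / (c₈ * Lj) := by
    refine h44m.2.trans ?_
    rw [mul_div_assoc]
    exact mul_le_mul_of_nonneg_left (div_le_div_of_nonneg_left hnr0.le hc₈L (hLlow _)) hC0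
  -- (45) twice: the second difference
  have hlogξ : 1 ≤ Real.log (classicalLocation (j : ℝ)) := one_le_log_classicalLocation (by linarith)
  have h45p := h45 (j : ℝ) ((j : ℝ) + n) hjr (by linarith) (by linarith) (by linarith)
  have h45m := h45 (j : ℝ) ((j : ℝ) - n) hjr (by linarith) (by linarith) (by linarith)
  have hdiff : |dp - dm| ≤ 2 * A * (n : ℝ) ^ 2 / j := by
    have e1 : dp - dm = (classicalLocation ((j : ℝ) + n) - classicalLocation (j : ℝ) -
        4 * π * ((j : ℝ) + n - j) / Real.log (classicalLocation (j : ℝ) / (4 * π))) +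
        (classicalLocation ((j : ℝ) - n) - classicalLocation (j : ℝ) -
        4 * π * ((j : ℝ) - n - j) / Real.log (classicalLocation (j : ℝ) / (4 * π))) := by
      rw [hdp, hdm, hξp, hξm, hξj]; ring
    rw [e1]
    refine (abs_add_le _ _).trans ?_
    have e2 : ((j : ℝ) + n - j) ^ 2 = (n : ℝ) ^ 2 := by ring
    have e3 : ((j : ℝ) - n - j) ^ 2 = (n : ℝ) ^ 2 := by ring
    rw [e2] at h45p
    rw [e3] at h45m
    have e4 : A * ((n : ℝ) ^ 2 / ((j : ℝ) * Real.log (classicalLocation (j : ℝ)) ^ 2)) ≤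
        A * ((n : ℝ) ^ 2 / (j : ℝ)) := by
      refine mul_le_mul_of_nonneg_left ?_ hA
      refine div_le_div_of_nonneg_left (by positivity) hjr0 ?_
      have : 1 ≤ Real.log (classicalLocation (j : ℝ)) ^ 2 := one_le_pow₀ hlogξ
      exact le_mul_of_one_le_right hjr0.le this
    calc |classicalLocation ((j : ℝ) + n) - classicalLocation (j : ℝ) -
            4 * π * ((j : ℝ) + n - j) / Real.log (classicalLocation (j : ℝ) / (4 * π))| +
          |classicalLocation ((j : ℝ) - n) - classicalLocation (j : ℝ) -
            4 * π * ((j : ℝ) - n - j) / Real.log (classicalLocation (j : ℝ) / (4 * π))|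
        ≤ A * ((n : ℝ) ^ 2 / ((j : ℝ) * Real.log (classicalLocation (j : ℝ)) ^ 2)) +
          A * ((n : ℝ) ^ 2 / ((j : ℝ) * Real.log (classicalLocation (j : ℝ)) ^ 2)) :=
          add_le_add h45p h45m
      _ ≤ A * ((n : ℝ) ^ 2 / (j : ℝ)) + A * ((n : ℝ) ^ 2 / (j : ℝ)) := add_le_add e4 e4
      _ = 2 * A * (n : ℝ) ^ 2 / j := by ring
  -- Lipschitz bounds for ψ
  have hψp : |truncWeight T (j + n) - truncWeight T j| ≤ 100 * n / N := by
    have := abs_truncWeight_sub_le hN0 j (j + n)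
    rwa [hcastp] at this
  have hψm : |truncWeight T (j + -(n : ℤ)) - truncWeight T j| ≤ 100 * n / N := by
    have := abs_truncWeight_sub_le hN0 j (j + -(n : ℤ))
    rwa [hcastm] at this
  exact abs_pair_le hnr1 hjr0 hN0 hc hP0 hc₈L hC0 hA hψp hψm (truncWeight_pos hN0 j).le
    (truncWeight_le_one hN0 j) hdp_low hdm_low hdp_up hdm_up hdiff


/-- The `p. 42` display for `j ≥ 1`: `|Σ_{k ∈ ℤ*, k ≠ j} ψ_T(k)/(ξ_k − ξ_j)³| ≤ K log₊⁴ j (1/j + 1/(T log T))`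
for `T ≥ 3`, with an absolute `K`. [cite: RodgersTaoFMP2020, Lemma 18 p. 42 (proof, display
«Σ_{k ≠ j} ψ_T(k)/(ξ_k − ξ_j)³ ≲ 1/|j| + 1/T»)] -/
private theorem abs_tsum_cubeTerm_le_pos :
    ∃ K : ℝ, 0 ≤ K ∧ ∀ T : ℝ, 3 ≤ T → ∀ j : ℤ, 1 ≤ j →
      Summable (fun k : ℤ ↦ if k = 0 ∨ k = j then (0 : ℝ) else truncWeight T k / (classicalLocationZ k - classicalLocationZ j) ^ 3) ∧
        |∑' k : ℤ, (if k = 0 ∨ k = j then (0 : ℝ) else truncWeight T k / (classicalLocationZ k - classicalLocationZ j) ^ 3)| ≤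
          K * logPlus j ^ 4 * (1 / (j : ℝ) + 1 / (T * Real.log T)) := by
  obtain ⟨c, C, B, c₈, C₈, A, hc, hcC, hB, hc₈, hc₈C₈, hA, h44, h43, h8, h45⟩ := exists_constants
  set S₃ : ℝ := ∑' m : ℤ, logPlus m ^ 3 / (m : ℝ) ^ 2 with hS₃
  have hS₃0 : 0 ≤ S₃ :=
    tsum_nonneg fun m ↦ div_nonneg (pow_nonneg (logPlus_nonneg _) 3) (sq_nonneg _)
  set D₀ : ℝ := Real.log (2 + B) with hD₀
  have hD₀0 : 0 ≤ D₀ := Real.log_nonneg (by linarith)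
  have hℓ : 0 < Real.log 2 := Real.log_pos one_lt_two
  have hC0 : 0 ≤ C := hc.le.trans hcC
  set p₀ : ℝ := D₀ / Real.log 2 + 3 with hp₀
  have hp₀0 : 0 < p₀ := by positivity
  set Kfar : ℝ := 2 * ((4 * p₀ ^ 3 / c ^ 3) * 4 / Real.log 2 + (4 / c ^ 3) * S₃ / Real.log 2 ^ 4)
    with hKfar
  set Knear : ℝ := 2 * (6 * A * C ^ 2 * p₀ ^ 6 / (c ^ 6 * c₈ ^ 2)) with hKnear
  set Klip : ℝ := 2 * ((200 * p₀ ^ 3 / c ^ 3) / Real.log 2) with hKlip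
  have hKfar0 : 0 ≤ Kfar := by positivity
  have hKnear0 : 0 ≤ Knear := by positivity
  have hKlip0 : 0 ≤ Klip := by positivity
  refine ⟨Kfar + Knear + Klip, by positivity, fun T hT j hj ↦ ?_⟩
  obtain ⟨hlogT, hN3, -⟩ := basic_T hT
  set N := T * Real.log T with hN
  have hN0 : 0 < N := by linarith
  have hj0 : (0 : ℤ) < j := by omega
  have hjr : (1 : ℝ) ≤ (j : ℝ) := by exact_mod_cast hj
  have hjr0 : (0 : ℝ) < (j : ℝ) := by linarith
  set Lj := logPlus (j : ℝ) with hLj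
  have hLjℓ : Real.log 2 ≤ Lj := log_two_le_logPlus _
  have hLj0 : 0 < Lj := logPlus_pos _
  set P : ℝ := D₀ + 3 * Lj with hP
  have hP0 : 0 < P := by positivity
  have hPle : P ≤ p₀ * Lj := by
    have : D₀ ≤ D₀ / Real.log 2 * Lj := by
      rw [div_mul_eq_mul_div, le_div_iff₀ hℓ]; exact mul_le_mul_of_nonneg_left hLjℓ hD₀0
    rw [hP, hp₀]; linarith
  have hQP : Real.log (2 + B) + 2 * logPlus (j : ℝ) ≤ P := by rw [hP]; linarith
  -- the shifted summand, summability, the shift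
  set h : ℤ → ℝ := fun m ↦ (if j + m = 0 ∨ j + m = j then (0 : ℝ) else truncWeight T (j + m) / (classicalLocationZ (j + m) - classicalLocationZ j) ^ 3) with hh
  have hdom : ∀ m, |h m| ≤ (4 * (P ^ 3 + logPlus m ^ 3) / (c ^ 3 * |(m : ℝ)| ^ 3)) := fun m ↦
    abs_cubeTerm_shift_le_maj hc hB h44 h43 hN0 hj0.ne' hQP m
  obtain ⟨hsum_shift, hsum⟩ := summable_cubeTerm hc hB h44 h43 hN0 hj0.ne'
  refine ⟨hsum, ?_⟩
  have hshift : ∑' k : ℤ, (if k = 0 ∨ k = j then (0 : ℝ) else truncWeight T k / (classicalLocationZ k - classicalLocationZ j) ^ 3) = ∑' m, h m :=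
    ((Equiv.addLeft j).tsum_eq (fun k : ℤ ↦ if k = 0 ∨ k = j then (0 : ℝ) else truncWeight T k / (classicalLocationZ k - classicalLocationZ j) ^ 3)).symm
  -- split into `|m| ≤ M` and `|m| > M`, `M = ⌊j/2⌋`
  set M : ℕ := j.toNat / 2 with hM
  have hjM1 : (j.toNat : ℤ) = j := Int.toNat_of_nonneg hj0.le
  have hM2 : 2 * (M : ℤ) ≤ j := by omega
  have hjM : j < 2 * ((M : ℤ) + 1) := by omega
  set F : Finset ℤ := Finset.Icc (-(M : ℤ)) M with hF
  have hsplit : ∑' m, h m = ∑ m ∈ F, h m + ∑' m : ((F : Set ℤ)ᶜ : Set ℤ), h m :=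
    (hsum_shift.sum_add_tsum_compl).symm
  -- far
  have hfar : |(∑' m : ((F : Set ℤ)ᶜ : Set ℤ), h m)| ≤
      (1 / ((M : ℝ) + 1)) * ((4 * P ^ 3 / c ^ 3) * 4 + (4 / c ^ 3) * S₃) :=
    abs_tsum_compl_le hP0.le hc hdom M
  have hMj : 1 / ((M : ℝ) + 1) ≤ 2 / (j : ℝ) := by
    rw [div_le_div_iff₀ (by positivity) hjr0]
    have : (j : ℝ) < 2 * ((M : ℝ) + 1) := by exact_mod_cast hjM
    linarith
  -- near
  have hnear_eq : ∑ m ∈ F, h m = ∑ n ∈ Finset.Icc 1 M, (h (n : ℤ) + h (-(n : ℤ))) := by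
    rw [hF, sum_Icc_neg_eq h M]
    simp [hh]
  have hpair : ∀ n ∈ Finset.Icc 1 M, |h (n : ℤ) + h (-(n : ℤ))| ≤
      6 * A * C ^ 2 * P ^ 6 / (c ^ 6 * (c₈ * Lj) ^ 2) * (1 / ((j : ℝ) * (n : ℝ) ^ 2)) +
        200 * P ^ 3 / (c ^ 3 * N) * (1 / (n : ℝ) ^ 2) := by
    intro n hn
    rw [Finset.mem_Icc] at hn
    have hnj : 2 * (n : ℤ) ≤ j := by omega
    exact abs_near_pair_le hc hcC hB hc₈ hA h44 h43 h8 h45 hT hj hn.1 hnj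
  have hnear : |∑ m ∈ F, h m| ≤
      2 * (6 * A * C ^ 2 * P ^ 6 / (c ^ 6 * (c₈ * Lj) ^ 2) * (1 / (j : ℝ)) +
        200 * P ^ 3 / (c ^ 3 * N)) := by
    rw [hnear_eq]
    refine (Finset.abs_sum_le_sum_abs _ _).trans ?_
    refine (Finset.sum_le_sum hpair).trans ?_
    have e1 : ∀ n : ℕ, 6 * A * C ^ 2 * P ^ 6 / (c ^ 6 * (c₈ * Lj) ^ 2) * (1 / ((j : ℝ) * (n : ℝ) ^ 2)) +
        200 * P ^ 3 / (c ^ 3 * N) * (1 / (n : ℝ) ^ 2) =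
        (6 * A * C ^ 2 * P ^ 6 / (c ^ 6 * (c₈ * Lj) ^ 2) * (1 / (j : ℝ)) +
          200 * P ^ 3 / (c ^ 3 * N)) * (1 / (n : ℝ) ^ 2) := by
      intro n
      rw [show 1 / ((j : ℝ) * (n : ℝ) ^ 2) = 1 / (j : ℝ) * (1 / (n : ℝ) ^ 2) by
        rw [one_div_mul_one_div]]
      ring
    simp_rw [e1]
    rw [← Finset.mul_sum]
    have h2 := sum_Icc_one_div_sq_le M
    have h0 : 0 ≤ 6 * A * C ^ 2 * P ^ 6 / (c ^ 6 * (c₈ * Lj) ^ 2) * (1 / (j : ℝ)) +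
        200 * P ^ 3 / (c ^ 3 * N) := by positivity
    calc (6 * A * C ^ 2 * P ^ 6 / (c ^ 6 * (c₈ * Lj) ^ 2) * (1 / (j : ℝ)) +
          200 * P ^ 3 / (c ^ 3 * N)) * ∑ n ∈ Finset.Icc 1 M, 1 / ((n : ℕ) : ℝ) ^ 2
        ≤ (6 * A * C ^ 2 * P ^ 6 / (c ^ 6 * (c₈ * Lj) ^ 2) * (1 / (j : ℝ)) +
          200 * P ^ 3 / (c ^ 3 * N)) * 2 := mul_le_mul_of_nonneg_left h2 h0
      _ = _ := by ring
  -- assemble: |S_j| ≤ |near| + |far|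
  have htot : |∑' k : ℤ, (if k = 0 ∨ k = j then (0 : ℝ) else truncWeight T k / (classicalLocationZ k - classicalLocationZ j) ^ 3)| ≤
      2 * (6 * A * C ^ 2 * P ^ 6 / (c ^ 6 * (c₈ * Lj) ^ 2) * (1 / (j : ℝ)) +
        200 * P ^ 3 / (c ^ 3 * N)) +
      (2 / (j : ℝ)) * ((4 * P ^ 3 / c ^ 3) * 4 + (4 / c ^ 3) * S₃) := by
    rw [hshift, hsplit]
    refine (abs_add_le _ _).trans (add_le_add hnear (hfar.trans ?_))
    exact mul_le_mul_of_nonneg_right hMj (by positivity)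
  -- convert each piece into `K · Lj⁴ · (1/j or 1/N)`
  have hP3 : P ^ 3 ≤ p₀ ^ 3 * Lj ^ 3 := by
    rw [← mul_pow]; exact pow_le_pow_left₀ hP0.le hPle 3
  have hP6 : P ^ 6 ≤ p₀ ^ 6 * Lj ^ 6 := by
    rw [← mul_pow]; exact pow_le_pow_left₀ hP0.le hPle 6
  have hL3 : Lj ^ 3 ≤ Lj ^ 4 / Real.log 2 := by
    rw [le_div_iff₀ hℓ, show Lj ^ 4 = Lj ^ 3 * Lj by ring]
    exact mul_le_mul_of_nonneg_left hLjℓ (by positivity)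
  have hL4 : 1 ≤ Lj ^ 4 / Real.log 2 ^ 4 := by
    rw [le_div_iff₀ (by positivity), one_mul]
    exact pow_le_pow_left₀ hℓ.le hLjℓ 4
  -- near piece
  have e_near : 2 * (6 * A * C ^ 2 * P ^ 6 / (c ^ 6 * (c₈ * Lj) ^ 2) * (1 / (j : ℝ))) ≤
      Knear * Lj ^ 4 * (1 / (j : ℝ)) := by
    have e1 : 6 * A * C ^ 2 * P ^ 6 / (c ^ 6 * (c₈ * Lj) ^ 2) ≤
        6 * A * C ^ 2 * (p₀ ^ 6 * Lj ^ 6) / (c ^ 6 * (c₈ * Lj) ^ 2) :=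
      div_le_div_of_nonneg_right (mul_le_mul_of_nonneg_left hP6 (by positivity)) (by positivity)
    have e2 : 6 * A * C ^ 2 * (p₀ ^ 6 * Lj ^ 6) / (c ^ 6 * (c₈ * Lj) ^ 2) =
        6 * A * C ^ 2 * p₀ ^ 6 / (c ^ 6 * c₈ ^ 2) * Lj ^ 4 := by
      field_simp
    rw [hKnear]
    have e3 := mul_le_mul_of_nonneg_right (e1.trans_eq e2) (show 0 ≤ 1 / (j : ℝ) by positivity)
    linarith [e3]
  -- Lipschitz piece
  have e_lip : 2 * (200 * P ^ 3 / (c ^ 3 * N)) ≤ Klip * Lj ^ 4 * (1 / N) := by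
    have e1 : 200 * P ^ 3 / (c ^ 3 * N) ≤ 200 * (p₀ ^ 3 * (Lj ^ 4 / Real.log 2)) / (c ^ 3 * N) :=
      div_le_div_of_nonneg_right (mul_le_mul_of_nonneg_left
        (hP3.trans (mul_le_mul_of_nonneg_left hL3 (by positivity))) (by norm_num)) (by positivity)
    have e2 : 200 * (p₀ ^ 3 * (Lj ^ 4 / Real.log 2)) / (c ^ 3 * N) =
        (200 * p₀ ^ 3 / c ^ 3) / Real.log 2 * Lj ^ 4 * (1 / N) := by
      field_simp
    rw [hKlip]
    have := e1.trans_eq e2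
    linarith [this]
  -- far piece
  have e_far : (2 / (j : ℝ)) * ((4 * P ^ 3 / c ^ 3) * 4 + (4 / c ^ 3) * S₃) ≤
      Kfar * Lj ^ 4 * (1 / (j : ℝ)) := by
    have e1 : 4 * P ^ 3 / c ^ 3 * 4 ≤ 4 * (p₀ ^ 3 * (Lj ^ 4 / Real.log 2)) / c ^ 3 * 4 := by
      have : P ^ 3 ≤ p₀ ^ 3 * (Lj ^ 4 / Real.log 2) :=
        hP3.trans (mul_le_mul_of_nonneg_left hL3 (by positivity))
      gcongr
    have e2 : (4 / c ^ 3) * S₃ ≤ (4 / c ^ 3) * S₃ * (Lj ^ 4 / Real.log 2 ^ 4) :=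
      le_mul_of_one_le_right (by positivity) hL4
    have e3 : 4 * (p₀ ^ 3 * (Lj ^ 4 / Real.log 2)) / c ^ 3 * 4 + (4 / c ^ 3) * S₃ * (Lj ^ 4 / Real.log 2 ^ 4)
        = ((4 * p₀ ^ 3 / c ^ 3) * 4 / Real.log 2 + (4 / c ^ 3) * S₃ / Real.log 2 ^ 4) * Lj ^ 4 := by
      field_simp
    have e4 : (4 * P ^ 3 / c ^ 3) * 4 + (4 / c ^ 3) * S₃ ≤
        ((4 * p₀ ^ 3 / c ^ 3) * 4 / Real.log 2 + (4 / c ^ 3) * S₃ / Real.log 2 ^ 4) * Lj ^ 4 := by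
      linarith [e1, e2, e3]
    rw [hKfar, show (2 / (j : ℝ)) = 2 * (1 / (j : ℝ)) by ring]
    have h2j : 0 ≤ 2 * (1 / (j : ℝ)) := by positivity
    have := mul_le_mul_of_nonneg_left e4 h2j
    linarith [this]
  -- total
  have hsum_pieces : Knear * Lj ^ 4 * (1 / (j : ℝ)) + Klip * Lj ^ 4 * (1 / N) +
      Kfar * Lj ^ 4 * (1 / (j : ℝ)) ≤ (Kfar + Knear + Klip) * Lj ^ 4 * (1 / (j : ℝ) + 1 / N) := by
    have h1 : 0 ≤ Knear * Lj ^ 4 * (1 / N) := by positivity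
    have h2 : 0 ≤ Klip * Lj ^ 4 * (1 / (j : ℝ)) := by positivity
    have h3 : 0 ≤ Kfar * Lj ^ 4 * (1 / N) := by positivity
    linarith [h1, h2, h3]
  linarith [htot, e_near, e_lip, e_far, hsum_pieces]


/-- The `p. 42` display for all `j ∈ ℤ*` (the case `j ≤ −1` by the oddness `g_{−j}(−k) = −g_j(k)`):
`Summable g_j` and `|Σ_k g_j(k)| ≤ K log₊⁴ j (1/|j| + 1/(T log T))` for `T ≥ 3`.
[cite: RodgersTaoFMP2020, Lemma 18 p. 42 (proof, display «Σ_{k ≠ j} ψ_T(k)/(ξ_k − ξ_j)³ ≲ 1/|j| + 1/T»)] -/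
private theorem abs_tsum_cubeTerm_le :
    ∃ K : ℝ, 0 ≤ K ∧ ∀ T : ℝ, 3 ≤ T → ∀ j : ℤ, j ≠ 0 →
      Summable (fun k : ℤ ↦ if k = 0 ∨ k = j then (0 : ℝ) else truncWeight T k / (classicalLocationZ k - classicalLocationZ j) ^ 3) ∧
        |∑' k : ℤ, (if k = 0 ∨ k = j then (0 : ℝ) else truncWeight T k / (classicalLocationZ k - classicalLocationZ j) ^ 3)| ≤
          K * logPlus j ^ 4 * (1 / |(j : ℝ)| + 1 / (T * Real.log T)) := by
  obtain ⟨K, hK, h⟩ := abs_tsum_cubeTerm_le_pos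
  refine ⟨K, hK, fun T hT j hj ↦ ?_⟩
  rcases lt_or_gt_of_ne hj with hneg | hpos
  · obtain ⟨hs, hb⟩ := h T hT (-j) (by omega)
    have hfun : (fun k : ℤ ↦ if k = 0 ∨ k = j then (0 : ℝ) else truncWeight T k / (classicalLocationZ k - classicalLocationZ j) ^ 3) =
        fun k ↦ -(if -k = 0 ∨ -k = -j then (0 : ℝ) else truncWeight T (-k) / (classicalLocationZ (-k) - classicalLocationZ (-j)) ^ 3) :=
      funext fun k ↦ (show (if k = 0 ∨ k = j then (0 : ℝ) else truncWeight T k / (classicalLocationZ k - classicalLocationZ j) ^ 3) =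
          -(if -k = 0 ∨ -k = -j then (0 : ℝ) else truncWeight T (-k) / (classicalLocationZ (-k) - classicalLocationZ (-j)) ^ 3) from by
        have := cubeTerm_neg_neg T (-j) (-k)
        simp only [neg_neg] at this
        linarith)
    have hs0 : Summable ((fun k : ℤ ↦ if k = 0 ∨ k = (-j) then (0 : ℝ) else truncWeight T k / (classicalLocationZ k - classicalLocationZ (-j)) ^ 3) ∘ (Equiv.neg ℤ)) :=
      (Equiv.neg ℤ).summable_iff.2 hs
    have hs1 : Summable (fun k ↦ (if -k = 0 ∨ -k = -j then (0 : ℝ) else truncWeight T (-k) / (classicalLocationZ (-k) - classicalLocationZ (-j)) ^ 3)) := by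
      simpa only [Function.comp_def, Equiv.neg_apply] using hs0
    have ht0 := (Equiv.neg ℤ).tsum_eq (fun k : ℤ ↦ if k = 0 ∨ k = (-j) then (0 : ℝ) else truncWeight T k / (classicalLocationZ k - classicalLocationZ (-j)) ^ 3)
    simp only [Equiv.neg_apply] at ht0
    have htsum : ∑' k : ℤ, (if k = 0 ∨ k = j then (0 : ℝ) else truncWeight T k / (classicalLocationZ k - classicalLocationZ j) ^ 3) =
        -∑' k : ℤ, (if k = 0 ∨ k = -j then (0 : ℝ) else truncWeight T k / (classicalLocationZ k - classicalLocationZ (-j)) ^ 3) := by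
      rw [hfun, tsum_neg, ht0]
    refine ⟨by rw [hfun]; exact hs1.neg, ?_⟩
    rw [htsum, abs_neg]
    have e1 : logPlus ((-j : ℤ) : ℝ) = logPlus (j : ℝ) := by push_cast; exact logPlus_neg _
    have e2 : (1 : ℝ) / ((-j : ℤ) : ℝ) = 1 / |(j : ℝ)| := by
      have : (j : ℝ) < 0 := by exact_mod_cast hneg
      rw [abs_of_neg this]; push_cast; ring
    rw [e1, e2] at hb
    exact hb
  · obtain ⟨hs, hb⟩ := h T hT j hpos
    refine ⟨hs, ?_⟩
    have : (0 : ℝ) < (j : ℝ) := by exact_mod_cast hpos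
    rwa [abs_of_pos this]


/-! ### B.1 Weighted sums of `ψ_T` against powers of `log₊` -/

/-- `psiN ≥ 0`. [folklore] -/
private theorem psiN_nonneg {N : ℝ} (hN : 0 < N) (q n : ℕ) : 0 ≤ ((1 + (n : ℝ) / N) ^ q)⁻¹ := by
  positivity

/-- `psiN ≤ 1`. [folklore] -/
private theorem psiN_le_one {N : ℝ} (hN : 0 < N) (q n : ℕ) : ((1 + (n : ℝ) / N) ^ q)⁻¹ ≤ 1 := by
  have h1 : 1 ≤ 1 + (n : ℝ) / N := by
    have : 0 ≤ (n : ℝ) / N := by positivity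
    linarith
  exact inv_le_one_of_one_le₀ (one_le_pow₀ h1)

/-- For `n ≥ N` and `q ≥ 2`: `(1 + n/N)^{−q} ≤ N²/n²`. [folklore] -/
private theorem psiN_le_sq_div {N : ℝ} (hN : 0 < N) {q : ℕ} (hq : 2 ≤ q) {n : ℕ} (hn : N ≤ n) :
    ((1 + (n : ℝ) / N) ^ q)⁻¹ ≤ N ^ 2 * (((n : ℝ)) ^ 2)⁻¹ := by
  have hn0 : (0 : ℝ) < n := hN.trans_le hn
  have h1 : (n : ℝ) / N ≤ 1 + (n : ℝ) / N := by linarith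
  have h2 : 1 ≤ (n : ℝ) / N := by rwa [le_div_iff₀ hN, one_mul]
  have h3 : ((n : ℝ) / N) ^ 2 ≤ (1 + (n : ℝ) / N) ^ q :=
    calc ((n : ℝ) / N) ^ 2 ≤ ((n : ℝ) / N) ^ q := pow_le_pow_right₀ h2 hq
      _ ≤ (1 + (n : ℝ) / N) ^ q := pow_le_pow_left₀ (by positivity) h1 q
  calc ((1 + (n : ℝ) / N) ^ q)⁻¹ ≤ (((n : ℝ) / N) ^ 2)⁻¹ := inv_anti₀ (by positivity) h3
    _ = N ^ 2 * ((n : ℝ) ^ 2)⁻¹ := by rw [div_pow]; field_simp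

/-- Partial sums: `Σ_{n<M} (1 + n/N)^{−q} ≤ 5N` for `N ≥ 1`, `q ≥ 2`. [folklore] -/
private theorem sum_range_psiN_le {N : ℝ} (hN : 1 ≤ N) {q : ℕ} (hq : 2 ≤ q) (M : ℕ) :
    ∑ n ∈ Finset.range M, ((1 + (n : ℝ) / N) ^ q)⁻¹ ≤ 5 * N := by
  have hN0 : 0 < N := one_pos.trans_le hN
  set K : ℕ := ⌈N⌉₊ with hK
  have hKN : N ≤ (K : ℝ) := Nat.le_ceil N
  have hK1 : (K : ℝ) < N + 1 := Nat.ceil_lt_add_one hN0.le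
  rw [← Finset.sum_filter_add_sum_filter_not (Finset.range M) (fun n ↦ n ≤ K)]
  have h1 : ∑ n ∈ (Finset.range M).filter (fun n ↦ n ≤ K), ((1 + (n : ℝ) / N) ^ q)⁻¹ ≤ (K : ℝ) + 1 := by
    calc ∑ n ∈ (Finset.range M).filter (fun n ↦ n ≤ K), ((1 + (n : ℝ) / N) ^ q)⁻¹
        ≤ ∑ n ∈ (Finset.range M).filter (fun n ↦ n ≤ K), (1 : ℝ) :=
          Finset.sum_le_sum fun n _ ↦ psiN_le_one hN0 q n
      _ = (((Finset.range M).filter (fun n ↦ n ≤ K)).card : ℝ) := by simp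
      _ ≤ ((Finset.range (K + 1)).card : ℝ) := by
          gcongr
          intro n hn
          simp only [Finset.mem_filter, Finset.mem_range] at hn ⊢
          omega
      _ = (K : ℝ) + 1 := by simp
  have h2 : ∑ n ∈ (Finset.range M).filter (fun n ↦ ¬ n ≤ K), ((1 + (n : ℝ) / N) ^ q)⁻¹ ≤ 2 * N := by
    calc ∑ n ∈ (Finset.range M).filter (fun n ↦ ¬ n ≤ K), ((1 + (n : ℝ) / N) ^ q)⁻¹
        ≤ ∑ n ∈ (Finset.range M).filter (fun n ↦ ¬ n ≤ K), N ^ 2 * (((n : ℝ)) ^ 2)⁻¹ := by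
          refine Finset.sum_le_sum fun n hn ↦ psiN_le_sq_div hN0 hq ?_
          simp only [Finset.mem_filter, not_le] at hn
          exact hKN.trans (by exact_mod_cast hn.2.le)
      _ = N ^ 2 * ∑ n ∈ (Finset.range M).filter (fun n ↦ ¬ n ≤ K), (((n : ℝ)) ^ 2)⁻¹ := by
          rw [Finset.mul_sum]
      _ ≤ N ^ 2 * ∑ n ∈ Finset.Ioo K M, (((n : ℝ)) ^ 2)⁻¹ := by
          refine mul_le_mul_of_nonneg_left
            (Finset.sum_le_sum_of_subset_of_nonneg (fun n hn ↦ ?_) fun _ _ _ ↦ by positivity)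
            (by positivity)
          simp only [Finset.mem_filter, Finset.mem_range, not_le] at hn
          simp only [Finset.mem_Ioo]
          exact ⟨hn.2, hn.1⟩
      _ ≤ N ^ 2 * (2 / ((K : ℝ) + 1)) := by gcongr; exact sum_Ioo_inv_sq_le K M
      _ ≤ N ^ 2 * (2 / N) := by gcongr; linarith
      _ = 2 * N := by field_simp
  linarith

/-- Summability and sum of the profile on `ℕ`. [folklore] -/
private theorem summable_psiN {N : ℝ} (hN : 1 ≤ N) {q : ℕ} (hq : 2 ≤ q) :
    Summable (fun n : ℕ ↦ ((1 + (n : ℝ) / N) ^ q)⁻¹) ∧ ∑' n : ℕ, ((1 + (n : ℝ) / N) ^ q)⁻¹ ≤ 5 * N :=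
  ⟨summable_of_sum_range_le (psiN_nonneg (one_pos.trans_le hN) q) (sum_range_psiN_le hN hq),
    Real.tsum_le_of_sum_range_le (psiN_nonneg (one_pos.trans_le hN) q) (sum_range_psiN_le hN hq)⟩

/-- Summability and sum of the profile on `ℤ`: `Σ_j (1 + |j|/N)^{−q} ≤ 10 N`. [folklore] -/
private theorem summable_psiZq {N : ℝ} (hN : 1 ≤ N) {q : ℕ} (hq : 2 ≤ q) :
    Summable (fun j : ℤ ↦ ((1 + |(j : ℝ)| / N) ^ q)⁻¹) ∧
      ∑' j : ℤ, ((1 + |(j : ℝ)| / N) ^ q)⁻¹ ≤ 10 * N := by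
  have hN0 : 0 < N := one_pos.trans_le hN
  set F : ℤ → ℝ := fun j ↦ ((1 + |(j : ℝ)| / N) ^ q)⁻¹ with hF
  have hnat : ∀ n : ℕ, F (n : ℤ) = ((1 + (n : ℝ) / N) ^ q)⁻¹ := fun n ↦ by simp [hF]
  have hneg : ∀ n : ℕ, F (-(n : ℤ)) = ((1 + (n : ℝ) / N) ^ q)⁻¹ := fun n ↦ by simp [hF]
  obtain ⟨hsN, htN⟩ := summable_psiN hN hq
  have hs : Summable F := by
    refine summable_int_iff_summable_nat_and_neg.2 ⟨?_, ?_⟩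
    · simpa only [hnat] using hsN
    · simpa only [hneg] using hsN
  refine ⟨hs, ?_⟩
  have h1 : HasSum (fun n : ℕ ↦ F n + F (-(n : ℤ))) (∑' j : ℤ, F j + F 0) := hs.hasSum.nat_add_neg
  have h2 : (fun n : ℕ ↦ F n + F (-(n : ℤ))) = fun n : ℕ ↦ 2 * ((1 + (n : ℝ) / N) ^ q)⁻¹ := by
    ext n; rw [hnat, hneg]; ring
  rw [h2] at h1
  have h3 : ∑' n : ℕ, 2 * ((1 + (n : ℝ) / N) ^ q)⁻¹ = 2 * ∑' n : ℕ, ((1 + (n : ℝ) / N) ^ q)⁻¹ :=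
    tsum_mul_left
  have h4 := h1.tsum_eq
  rw [h3] at h4
  have h5 : 0 ≤ F 0 := by simp only [hF]; positivity
  show ∑' j : ℤ, F j ≤ 10 * N
  linarith

/-- Pointwise: `ψ_T(j) log₊^p j ≤ (log(2 + N) + 1)^p (1 + |j|/N)^{−(100−p)}`, `N = T log T > 0`,
`p ≤ 100` (from `log₊ j ≤ log(2 + N) + |j|/N ≤ (log(2+N) + 1)(1 + |j|/N)`).
[cite: RodgersTaoFMP2020, §7 p. 42 (66)] -/
private theorem truncWeight_mul_logPlus_pow_le {T : ℝ} (hT : 0 < T * Real.log T) {p : ℕ} (hp : p ≤ 100)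
    (j : ℤ) :
    truncWeight T j * logPlus j ^ p ≤
      (Real.log (2 + T * Real.log T) + 1) ^ p *
        ((1 + |(j : ℝ)| / (T * Real.log T)) ^ (100 - p))⁻¹ := by
  set N := T * Real.log T with hN
  set u := |(j : ℝ)| / N with hu
  have hu0 : 0 ≤ u := by positivity
  set a := Real.log (2 + N) with ha
  have ha0 : 0 ≤ a := Real.log_nonneg (by linarith)
  have h1 : logPlus (j : ℝ) ≤ a + u := by
    rw [logPlus_eq]
    have h2 : 2 + |(j : ℝ)| ≤ (2 + N) * (1 + u) := by
      have : (2 + N) * (1 + u) = 2 + N + 2 * u + |(j : ℝ)| := by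
        rw [hu]; field_simp; ring
      rw [this]; linarith
    have h3 : Real.log (1 + u) ≤ u := by
      have := Real.log_le_sub_one_of_pos (by linarith : (0 : ℝ) < 1 + u); linarith
    calc Real.log (2 + |(j : ℝ)|) ≤ Real.log ((2 + N) * (1 + u)) :=
          Real.log_le_log (by positivity) h2
      _ = Real.log (2 + N) + Real.log (1 + u) := Real.log_mul (by positivity) (by positivity)
      _ ≤ a + u := by linarith
  have h4 : logPlus (j : ℝ) ≤ (a + 1) * (1 + u) := h1.trans (by nlinarith)
  have h5 : logPlus (j : ℝ) ^ p ≤ (a + 1) ^ p * (1 + u) ^ p := by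
    rw [← mul_pow]; exact pow_le_pow_left₀ (logPlus_nonneg _) h4 p
  have hψ : truncWeight T j = ((1 + u) ^ 100)⁻¹ := by rw [truncWeight_eq]
  rw [hψ]
  have h1u : 0 < 1 + u := by linarith
  have hsplit : (1 + u) ^ 100 = (1 + u) ^ p * (1 + u) ^ (100 - p) := by
    rw [← pow_add]; congr 1; omega
  calc ((1 + u) ^ 100)⁻¹ * logPlus (j : ℝ) ^ p
      ≤ ((1 + u) ^ 100)⁻¹ * ((a + 1) ^ p * (1 + u) ^ p) :=
        mul_le_mul_of_nonneg_left h5 (by positivity)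
    _ = (a + 1) ^ p * ((1 + u) ^ (100 - p))⁻¹ := by
        rw [hsplit]; field_simp

/-- `Σ_j ψ_T(j) log₊^p j ≤ (log(2 + T log T) + 1)^p · 10 T log T` (with summability), for `T ≥ 3`
and `p ≤ 98`. [cite: RodgersTaoFMP2020, §7 p. 42 (66)] -/
theorem tsum_truncWeight_mul_logPlus_pow_le {T : ℝ} (hT : 3 ≤ T) {p : ℕ} (hp : p ≤ 98) :
    Summable (fun j : ℤ ↦ truncWeight T j * logPlus j ^ p) ∧
      ∑' j : ℤ, truncWeight T j * logPlus j ^ p ≤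
        (Real.log (2 + T * Real.log T) + 1) ^ p * (10 * (T * Real.log T)) := by
  obtain ⟨hlogT, hN3, -⟩ := basic_T hT
  set N := T * Real.log T with hN
  have hN1 : 1 ≤ N := by linarith
  have hN0 : 0 < N := by linarith
  have hq : 2 ≤ 100 - p := by omega
  obtain ⟨hsZ, htZ⟩ := summable_psiZq hN1 hq
  have hpt := fun j ↦ truncWeight_mul_logPlus_pow_le hN0 (show p ≤ 100 by omega) j
  have hmaj : Summable (fun j : ℤ ↦ (Real.log (2 + N) + 1) ^ p *
      ((1 + |(j : ℝ)| / N) ^ (100 - p))⁻¹) := hsZ.mul_left _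
  have hnn : ∀ j : ℤ, 0 ≤ truncWeight T j * logPlus j ^ p := fun j ↦
    mul_nonneg (truncWeight_pos hN0 j).le (pow_nonneg (logPlus_nonneg _) p)
  have hs : Summable (fun j : ℤ ↦ truncWeight T j * logPlus j ^ p) :=
    Summable.of_nonneg_of_le hnn hpt hmaj
  refine ⟨hs, ?_⟩
  have ha0 : 0 ≤ Real.log (2 + N) + 1 := by
    have := Real.log_nonneg (by linarith : (1 : ℝ) ≤ 2 + N); linarith
  calc ∑' j : ℤ, truncWeight T j * logPlus j ^ p
      ≤ ∑' j : ℤ, (Real.log (2 + N) + 1) ^ p * ((1 + |(j : ℝ)| / N) ^ (100 - p))⁻¹ :=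
        hs.tsum_le_tsum hpt hmaj
    _ = (Real.log (2 + N) + 1) ^ p * ∑' j : ℤ, ((1 + |(j : ℝ)| / N) ^ (100 - p))⁻¹ := tsum_mul_left
    _ ≤ (Real.log (2 + N) + 1) ^ p * (10 * N) :=
        mul_le_mul_of_nonneg_left htZ (pow_nonneg ha0 p)


/-- `log(2 + T log T) + 1 ≤ 3 log T` for `T ≥ 3`. [folklore] -/
private theorem log_add_one_le {T : ℝ} (hT : 3 ≤ T) :
    Real.log (2 + T * Real.log T) + 1 ≤ 3 * Real.log T := by
  obtain ⟨hlogT, -, h⟩ := basic_T hT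
  linarith

/-- `Σ_j ψ_T(j) log₊^p j ≤ 10 · 3^p · (T log T) · log^p T` for `T ≥ 3`, `p ≤ 98`.
[cite: RodgersTaoFMP2020, §7 p. 42 (66)] -/
theorem tsum_truncWeight_mul_logPlus_pow_le' {T : ℝ} (hT : 3 ≤ T) {p : ℕ} (hp : p ≤ 98) :
    ∑' j : ℤ, truncWeight T j * logPlus j ^ p ≤ 10 * 3 ^ p * (T * Real.log T) * Real.log T ^ p := by
  obtain ⟨hlogT, hN3, -⟩ := basic_T hT
  obtain ⟨-, h⟩ := tsum_truncWeight_mul_logPlus_pow_le hT hp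
  have h1 : (Real.log (2 + T * Real.log T) + 1) ^ p ≤ (3 * Real.log T) ^ p :=
    pow_le_pow_left₀ (by have := Real.log_nonneg (by linarith : (1:ℝ) ≤ 2 + T * Real.log T); linarith)
      (log_add_one_le hT) p
  have h2 : 0 ≤ 10 * (T * Real.log T) := by positivity
  calc ∑' j : ℤ, truncWeight T j * logPlus j ^ p
      ≤ (Real.log (2 + T * Real.log T) + 1) ^ p * (10 * (T * Real.log T)) := h
    _ ≤ (3 * Real.log T) ^ p * (10 * (T * Real.log T)) := mul_le_mul_of_nonneg_right h1 h2
    _ = 10 * 3 ^ p * (T * Real.log T) * Real.log T ^ p := by rw [mul_pow]; ring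

/-- The harmonic bound `Σ_{n=1}^{K} 1/n ≤ 1 + log K`. [folklore] -/
private theorem sum_Icc_one_div_le_log (K : ℕ) :
    ∑ n ∈ Finset.Icc 1 K, 1 / ((n : ℕ) : ℝ) ≤ 1 + Real.log K := by
  have h := harmonic_le_one_add_log K
  rw [harmonic_eq_sum_Icc] at h
  push_cast at h
  simpa [one_div] using h

/-- `Σ_j ψ_T(j) log₊^p j/|j| ≤ 16 · 3^p · log^{p+1} T` (with summability; the term at `j = 0` is
`0`), for `T ≥ 3`, `p ≤ 98`: split at `|j| ≤ T log T` (harmonic sum) and use `1/|j| ≤ 1/(T log T)`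
beyond. [cite: RodgersTaoFMP2020, §7 p. 42 (66)] -/
theorem tsum_truncWeight_mul_logPlus_pow_div_le {T : ℝ} (hT : 3 ≤ T) {p : ℕ} (hp : p ≤ 98) :
    Summable (fun j : ℤ ↦ truncWeight T j * logPlus j ^ p / |(j : ℝ)|) ∧
      ∑' j : ℤ, truncWeight T j * logPlus j ^ p / |(j : ℝ)| ≤ 16 * 3 ^ p * Real.log T ^ (p + 1) := by
  obtain ⟨hlogT, hN3, hlog2N⟩ := basic_T hT
  set N := T * Real.log T with hN
  have hN0 : 0 < N := by linarith
  have hT0 : 0 < T := by linarith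
  obtain ⟨hsW, -⟩ := tsum_truncWeight_mul_logPlus_pow_le hT hp
  have htW := tsum_truncWeight_mul_logPlus_pow_le' hT hp
  set a := logPlus N with ha
  have haN : a = Real.log (2 + N) := by rw [ha, logPlus_eq, abs_of_pos hN0]
  have ha0 : 0 ≤ a := logPlus_nonneg _
  have ha3 : a ≤ 3 * Real.log T := by rw [haN]; linarith
  set K : ℕ := ⌊N⌋₊ with hK
  have hKN : (K : ℝ) ≤ N := Nat.floor_le hN0.le
  have hNK : N < (K : ℝ) + 1 := Nat.lt_floor_add_one N
  -- the two majorants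
  set e : ℤ → ℝ := fun j ↦ if j ≠ 0 ∧ |j| ≤ K then a ^ p / |(j : ℝ)| else 0 with he
  set f : ℤ → ℝ := fun j ↦ (1 / N) * (truncWeight T j * logPlus j ^ p) with hf
  have hnn : ∀ j : ℤ, 0 ≤ truncWeight T j * logPlus j ^ p / |(j : ℝ)| := fun j ↦
    div_nonneg (mul_nonneg (truncWeight_pos hN0 j).le (pow_nonneg (logPlus_nonneg _) p))
      (abs_nonneg _)
  have he0 : ∀ j, 0 ≤ e j := fun j ↦ by
    simp only [he]; split_ifs
    · positivity
    · exact le_rfl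
  have hf0 : ∀ j, 0 ≤ f j := fun j ↦
    mul_nonneg (by positivity) (mul_nonneg (truncWeight_pos hN0 j).le (pow_nonneg (logPlus_nonneg _) p))
  have hpt : ∀ j : ℤ, truncWeight T j * logPlus j ^ p / |(j : ℝ)| ≤ e j + f j := by
    intro j
    rcases eq_or_ne j 0 with rfl | hj
    · simp only [Int.cast_zero, abs_zero, div_zero]
      exact add_nonneg (he0 0) (hf0 0)
    by_cases hjK : |j| ≤ (K : ℤ)
    · -- small |j|: ψ ≤ 1 and log₊ j ≤ log₊ N = a
      have hjN : |(j : ℝ)| ≤ N := by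
        have : ((|j| : ℤ) : ℝ) ≤ (K : ℝ) := by exact_mod_cast hjK
        rw [Int.cast_abs] at this; linarith
      have h1 : logPlus (j : ℝ) ≤ a := logPlus_mono (by rw [abs_of_pos hN0]; exact hjN)
      have h2 : truncWeight T j * logPlus j ^ p ≤ 1 * a ^ p :=
        mul_le_mul (truncWeight_le_one hN0 j) (pow_le_pow_left₀ (logPlus_nonneg _) h1 p)
          (pow_nonneg (logPlus_nonneg _) p) zero_le_one
      have h3 : e j = a ^ p / |(j : ℝ)| := by simp only [he, if_pos (And.intro hj hjK)]
      rw [h3]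
      rw [one_mul] at h2
      calc truncWeight T j * logPlus j ^ p / |(j : ℝ)| ≤ a ^ p / |(j : ℝ)| :=
            div_le_div_of_nonneg_right h2 (abs_nonneg _)
        _ ≤ a ^ p / |(j : ℝ)| + f j := le_add_of_nonneg_right (hf0 j)
    · -- large |j|: 1/|j| ≤ 1/N
      have hjN : N ≤ |(j : ℝ)| := by
        have h' : (K : ℤ) + 1 ≤ |j| := by omega
        have h'' : ((K : ℝ)) + 1 ≤ |(j : ℝ)| := by
          rw [← Int.cast_abs]; exact_mod_cast h'
        linarith
      calc truncWeight T j * logPlus j ^ p / |(j : ℝ)|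
          ≤ truncWeight T j * logPlus j ^ p / N :=
            div_le_div_of_nonneg_left (mul_nonneg (truncWeight_pos hN0 j).le
              (pow_nonneg (logPlus_nonneg _) p)) hN0 hjN
        _ = f j := by simp only [hf]; ring
        _ ≤ e j + f j := le_add_of_nonneg_left (he0 j)
  -- the finite sum Σ e
  have hesupp : ∀ j ∉ Finset.Icc (-(K : ℤ)) K, e j = 0 := by
    intro j hj
    simp only [Finset.mem_Icc, not_and_or, not_le] at hj
    simp only [he]
    rw [if_neg]
    rintro ⟨-, h2⟩
    rcases hj with hj | hj
    · have := neg_abs_le j; omega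
    · have := le_abs_self j; omega
  have hes : Summable e := summable_of_ne_finset_zero hesupp
  have het : ∑' j, e j = ∑ j ∈ Finset.Icc (-(K : ℤ)) K, e j := tsum_eq_sum hesupp
  have hesum_le : ∑' j, e j ≤ 2 * a ^ p * (1 + Real.log K) := by
    rw [het, sum_Icc_neg_eq e K]
    have h0 : e 0 = 0 := by simp [he]
    have h1 : ∀ n ∈ Finset.Icc 1 K, e (n : ℤ) + e (-(n : ℤ)) = 2 * a ^ p * (1 / ((n : ℕ) : ℝ)) := by
      intro n hn
      rw [Finset.mem_Icc] at hn
      have hn0 : (n : ℤ) ≠ 0 := by omega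
      have hnK : |(n : ℤ)| ≤ K := by rw [abs_of_nonneg (by omega)]; exact_mod_cast hn.2
      have e1 : e (n : ℤ) = a ^ p / (n : ℝ) := by
        simp only [he, if_pos (And.intro hn0 hnK)]
        push_cast; rw [abs_of_nonneg (by positivity)]
      have e2 : e (-(n : ℤ)) = a ^ p / (n : ℝ) := by
        have hn0' : (-(n : ℤ)) ≠ 0 := by omega
        have hnK' : |(-(n : ℤ))| ≤ K := by rw [abs_neg]; exact hnK
        simp only [he, if_pos (And.intro hn0' hnK')]
        push_cast; rw [abs_neg, abs_of_nonneg (by positivity)]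
      rw [e1, e2]; ring
    rw [h0, zero_add, Finset.sum_congr rfl h1, ← Finset.mul_sum]
    exact mul_le_mul_of_nonneg_left (sum_Icc_one_div_le_log K) (by positivity)
  have hlogK : Real.log K ≤ 2 * Real.log T := by
    rcases Nat.eq_zero_or_pos K with hK0 | hKpos
    · rw [hK0]; simp; linarith
    · have hK1 : (0 : ℝ) < K := by exact_mod_cast hKpos
      have hNT : N ≤ T ^ 2 := by
        have : Real.log T ≤ T := (Real.log_le_sub_one_of_pos hT0).trans (by linarith)
        rw [hN]; nlinarith
      calc Real.log K ≤ Real.log N := Real.log_le_log hK1 hKN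
        _ ≤ Real.log (T ^ 2) := Real.log_le_log hN0 hNT
        _ = 2 * Real.log T := by rw [Real.log_pow]; norm_num
  -- Σ f
  have hfs : Summable f := hsW.mul_left _
  have hft : ∑' j, f j = (1 / N) * ∑' j, truncWeight T j * logPlus j ^ p := tsum_mul_left
  have hft_le : ∑' j, f j ≤ 10 * 3 ^ p * Real.log T ^ p := by
    rw [hft]
    calc (1 / N) * ∑' j : ℤ, truncWeight T j * logPlus j ^ p
        ≤ (1 / N) * (10 * 3 ^ p * N * Real.log T ^ p) :=
          mul_le_mul_of_nonneg_left htW (by positivity)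
      _ = 10 * 3 ^ p * Real.log T ^ p := by field_simp
  -- assemble
  have hs : Summable (fun j : ℤ ↦ truncWeight T j * logPlus j ^ p / |(j : ℝ)|) :=
    Summable.of_nonneg_of_le hnn hpt (hes.add hfs)
  refine ⟨hs, ?_⟩
  have hap : a ^ p ≤ (3 * Real.log T) ^ p := pow_le_pow_left₀ ha0 ha3 p
  have hlp : 0 ≤ Real.log T ^ p := by positivity
  calc ∑' j : ℤ, truncWeight T j * logPlus j ^ p / |(j : ℝ)|
      ≤ ∑' j, (e j + f j) := hs.tsum_le_tsum hpt (hes.add hfs)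
    _ = ∑' j, e j + ∑' j, f j := hes.tsum_add hfs
    _ ≤ 2 * a ^ p * (1 + Real.log K) + 10 * 3 ^ p * Real.log T ^ p := add_le_add hesum_le hft_le
    _ ≤ 2 * (3 * Real.log T) ^ p * (3 * Real.log T) + 10 * 3 ^ p * Real.log T ^ p * Real.log T := by
        have h1 : 1 + Real.log K ≤ 3 * Real.log T := by linarith
        have h2 : 2 * a ^ p * (1 + Real.log K) ≤ 2 * (3 * Real.log T) ^ p * (3 * Real.log T) :=
          mul_le_mul (mul_le_mul_of_nonneg_left hap (by norm_num)) h1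
            (by have := Real.log_natCast_nonneg K; linarith)
            (by positivity)
        have h3 : 10 * 3 ^ p * Real.log T ^ p ≤ 10 * 3 ^ p * Real.log T ^ p * Real.log T :=
          le_mul_of_one_le_right (by positivity) hlogT
        linarith
    _ = 16 * 3 ^ p * Real.log T ^ (p + 1) := by rw [mul_pow]; ring


/-! ### B.3 The (63)-correction over `ℤ* × ℤ*`: Fubini, desymmetrisation, and the bound -/

/-- `Σ_m maj_Q(m) ≤ 4Q³/c³ · 4 + 4/c³ · S₃`. [cite: RodgersTaoFMP2020, Lemma 18 p. 42 (proof)] -/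
private theorem tsum_maj_le {Q c : ℝ} (hQ : 0 ≤ Q) (hc : 0 < c) :
    ∑' m : ℤ, (4 * (Q ^ 3 + logPlus m ^ 3) / (c ^ 3 * |(m : ℝ)| ^ 3)) ≤
      (4 * Q ^ 3 / c ^ 3) * 4 + (4 / c ^ 3) * ∑' m : ℤ, logPlus m ^ 3 / (m : ℝ) ^ 2 :=
  ((summable_maj hQ hc).tsum_le_tsum (maj_le hQ hc)
    ((summable_one_div_sq.mul_left _).add (summable_logPlus_cube_div_sq.mul_left _))).trans
    (tsum_majBound_le hQ hc)

/-- The location deviation `a_j(t) := x_j(t) − ξ_j` on `ℤ` vanishes at the junk index `0` and is odd.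
[cite: RodgersTaoFMP2020, §1.2 p. 7] -/
theorem deviation_zero (t : ℝ) : deBruijnZeroZ t 0 - classicalLocationZ 0 = 0 := by simp

/-- Under the (50)-shape location law at time `t` (constant `B`, indices `n ≥ 1`), for every
`j ∈ ℤ`: `|x_j(t) − ξ_j| ≤ max B 0 · C₈ · log₊ j` (oddness for `j ≤ −1`; `C₈` from (43):
`log₊ ξ_y ≤ C₈ log₊ y`). [cite: RodgersTaoFMP2020, Corollary 10 (50) p. 23] -/
theorem abs_deviation_le {C₈ c₈ : ℝ}
    (h8 : ∀ y : ℝ, 1 ≤ y → c₈ * logPlus y ≤ logPlus (classicalLocation y) ∧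
      logPlus (classicalLocation y) ≤ C₈ * logPlus y)
    {t B : ℝ}
    (h50 : ∀ n : ℕ, 1 ≤ n →
      |deBruijnZero t n - classicalLocation (n : ℝ)| ≤ B * logPlus (classicalLocation (n : ℝ)))
    (j : ℤ) :
    |deBruijnZeroZ t j - classicalLocationZ j| ≤ max B 0 * C₈ * logPlus j := by
  have hC₈ : 0 ≤ C₈ := by
    have := h8 1 le_rfl
    have h0 : 0 < logPlus (1 : ℝ) := logPlus_pos _
    have h1 : 0 ≤ logPlus (classicalLocation 1) := logPlus_nonneg _
    nlinarith [this.2]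
  have key : ∀ j : ℤ, 1 ≤ j → |deBruijnZeroZ t j - classicalLocationZ j| ≤ max B 0 * C₈ * logPlus j := by
    intro j hj
    have hjr : (1 : ℝ) ≤ (j : ℝ) := by exact_mod_cast hj
    have h1 := location_int_of_nat h50 hj
    rw [classicalLocationZ_of_pos (by omega)]
    refine h1.trans ?_
    have h2 : B * logPlus (classicalLocation (j : ℝ)) ≤ max B 0 * logPlus (classicalLocation (j : ℝ)) :=
      mul_le_mul_of_nonneg_right (le_max_left _ _) (logPlus_nonneg _)
    have h3 : max B 0 * logPlus (classicalLocation (j : ℝ)) ≤ max B 0 * (C₈ * logPlus (j : ℝ)) :=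
      mul_le_mul_of_nonneg_left (h8 (j : ℝ) hjr).2 (le_max_right _ _)
    linarith
  rcases lt_trichotomy j 0 with hneg | rfl | hpos
  · have h1 := key (-j) (by omega)
    rw [deBruijnZeroZ_neg, classicalLocationZ_neg, ← neg_sub', abs_neg, Int.cast_neg, logPlus_neg]
      at h1
    rwa [show deBruijnZeroZ t j - classicalLocationZ j =
      -(classicalLocationZ j - deBruijnZeroZ t j) by ring, abs_neg, abs_sub_comm]
  · rw [deviation_zero, abs_zero]
    exact mul_nonneg (mul_nonneg (le_max_right _ _) hC₈) (logPlus_nonneg _)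
  · exact key j (by omega)

/-- `G` agrees with the (63)-correction on the off-diagonal pairs of `ℤ*`.
[cite: RodgersTaoFMP2020, §7 p. 40 (63); Lemma 18 p. 42 (proof)] -/
private theorem corrSym_eq {T t : ℝ} (p : zstarOffDiag) :
    (-(2 * truncWeight T p.1.2 * (deBruijnZeroZ t p.1.2 - classicalLocationZ p.1.2) * (if p.1.1 = 0 ∨ p.1.1 = p.1.2 then (0 : ℝ) else truncWeight T p.1.1 / (classicalLocationZ p.1.1 - classicalLocationZ p.1.2) ^ 3)) - (2 * truncWeight T p.1.1 * (deBruijnZeroZ t p.1.1 - classicalLocationZ p.1.1) * (if p.1.2 = 0 ∨ p.1.2 = p.1.1 then (0 : ℝ) else truncWeight T p.1.2 / (classicalLocationZ p.1.2 - classicalLocationZ p.1.1) ^ 3))) =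
      truncWeight T p.1.1 * truncWeight T p.1.2 *
      (2 * ((deBruijnZeroZ t p.1.2 - classicalLocationZ p.1.2) -
        (deBruijnZeroZ t p.1.1 - classicalLocationZ p.1.1)) /
        (classicalLocationZ p.1.2 - classicalLocationZ p.1.1) ^ 3) := by
  obtain ⟨⟨j, k⟩, hj, hk, hjk⟩ := p
  simp only at hj hk hjk
  dsimp only
  rw [cubeTerm_of_ne hj hjk, cubeTerm_of_ne hk (Ne.symm hjk)]
  have hξ : classicalLocationZ k - classicalLocationZ j ≠ 0 := classicalLocationZ_sub_ne_zero hjk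
  have h3 : (classicalLocationZ j - classicalLocationZ k) ^ 3 = -(classicalLocationZ k - classicalLocationZ j) ^ 3 := by
    ring
  rw [h3]
  field_simp

/-- `G` vanishes off `ℤ* × ℤ* ∖ Δ`. [cite: RodgersTaoFMP2020, Lemma 18 p. 42 (proof)] -/
private theorem corrSym_eq_zero {T t : ℝ} {q : ℤ × ℤ} (hq : q ∉ zstarOffDiag) :
    (-(2 * truncWeight T q.2 * (deBruijnZeroZ t q.2 - classicalLocationZ q.2) * (if q.1 = 0 ∨ q.1 = q.2 then (0 : ℝ) else truncWeight T q.1 / (classicalLocationZ q.1 - classicalLocationZ q.2) ^ 3)) - (2 * truncWeight T q.1 * (deBruijnZeroZ t q.1 - classicalLocationZ q.1) * (if q.2 = 0 ∨ q.2 = q.1 then (0 : ℝ) else truncWeight T q.2 / (classicalLocationZ q.2 - classicalLocationZ q.1) ^ 3))) = 0 := by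
  obtain ⟨j, k⟩ := q
  simp only [mem_zstarOffDiag, not_and_or, not_not] at hq
  dsimp only
  rcases hq with rfl | rfl | rfl
  · simp
  · simp
  · simp


/-- The desymmetrised family `F(j,k) = 2ψ_T(j) a_j g_j(k)` is absolutely summable on `ℤ × ℤ`
under the (50)-shape location law at time `t`, every row is summable, and
`|Σ_{(j,k)} F(j,k)| ≤ C · max B 0 · log⁶ T` (Fubini: `Σ F = Σ_j 2ψ_T(j) a_j S_j`, then the `p. 42`
display for `S_j` and the weighted sums of B.1–B.2). [cite: RodgersTaoFMP2020, Lemma 18 p. 42 (proof)] -/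
private theorem abs_tsum_desym_le :
    ∃ C : ℝ, 0 ≤ C ∧ ∀ B T t : ℝ, 3 ≤ T →
      (∀ n : ℕ, 1 ≤ n →
        |deBruijnZero t n - classicalLocation (n : ℝ)| ≤ B * logPlus (classicalLocation (n : ℝ))) →
      Summable (fun q : ℤ × ℤ ↦ (2 * truncWeight T q.1 * (deBruijnZeroZ t q.1 - classicalLocationZ q.1) * (if q.2 = 0 ∨ q.2 = q.1 then (0 : ℝ) else truncWeight T q.2 / (classicalLocationZ q.2 - classicalLocationZ q.1) ^ 3))) ∧
      (∀ j : ℤ, Summable fun k : ℤ ↦ (2 * truncWeight T j * (deBruijnZeroZ t j - classicalLocationZ j) * (if k = 0 ∨ k = j then (0 : ℝ) else truncWeight T k / (classicalLocationZ k - classicalLocationZ j) ^ 3))) ∧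
        |∑' q : ℤ × ℤ, (2 * truncWeight T q.1 * (deBruijnZeroZ t q.1 - classicalLocationZ q.1) * (if q.2 = 0 ∨ q.2 = q.1 then (0 : ℝ) else truncWeight T q.2 / (classicalLocationZ q.2 - classicalLocationZ q.1) ^ 3))| ≤ C * max B 0 * Real.log T ^ 6 := by
  obtain ⟨c, C, B₈, c₈, C₈, A, hc, hcC, hB₈, hc₈, hc₈C₈, hA, h44, h43, h8, h45⟩ := exists_constants
  obtain ⟨K, hK, hcore⟩ := abs_tsum_cubeTerm_le
  set S₃ : ℝ := ∑' m : ℤ, logPlus m ^ 3 / (m : ℝ) ^ 2 with hS₃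
  have hS₃0 : 0 ≤ S₃ :=
    tsum_nonneg fun m ↦ div_nonneg (pow_nonneg (logPlus_nonneg _) 3) (sq_nonneg _)
  have hC₈0 : 0 ≤ C₈ := hc₈.le.trans hc₈C₈
  have hℓ : 0 < Real.log 2 := Real.log_pos one_lt_two
  refine ⟨2 * K * C₈ * (26 * 3 ^ 5), by positivity, fun B T t hT h50 ↦ ?_⟩
  set F : ℤ × ℤ → ℝ := (fun q : ℤ × ℤ ↦ (2 * truncWeight T q.1 * (deBruijnZeroZ t q.1 - classicalLocationZ q.1) * (if q.2 = 0 ∨ q.2 = q.1 then (0 : ℝ) else truncWeight T q.2 / (classicalLocationZ q.2 - classicalLocationZ q.1) ^ 3))) with hF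
  obtain ⟨hlogT, hN3, -⟩ := basic_T hT
  set N := T * Real.log T with hN
  have hN0 : 0 < N := by linarith
  set Bp := max B 0 with hBp
  have hBp0 : 0 ≤ Bp := le_max_right _ _
  have hdev : ∀ j : ℤ, |deBruijnZeroZ t j - classicalLocationZ j| ≤ Bp * C₈ * logPlus j :=
    abs_deviation_le h8 h50
  have ha0 : deBruijnZeroZ t 0 - classicalLocationZ 0 = 0 := deviation_zero t
  -- the majorant on ℤ × ℤ
  set Q : ℤ → ℝ := fun j ↦ Real.log (2 + B₈) + 2 * logPlus j with hQ
  have hQ0 : ∀ j, 0 ≤ Q j := fun j ↦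
    add_nonneg (Real.log_nonneg (by linarith)) (mul_nonneg zero_le_two (logPlus_nonneg _))
  set M : ℤ × ℤ → ℝ := fun q ↦
    2 * truncWeight T q.1 * (Bp * C₈ * logPlus q.1) * (4 * ((Q q.1) ^ 3 + logPlus (((q.2 - q.1) : ℤ) : ℝ) ^ 3) / (c ^ 3 * |(((q.2 - q.1) : ℤ) : ℝ)| ^ 3)) with hM
  have hM0 : ∀ q, 0 ≤ M q := fun q ↦
    mul_nonneg (mul_nonneg (mul_nonneg zero_le_two (truncWeight_pos hN0 _).le)
      (mul_nonneg (mul_nonneg hBp0 hC₈0) (logPlus_nonneg _))) (maj_nonneg (hQ0 _) hc _)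
  have hFM : ∀ q, |F q| ≤ M q := by
    rintro ⟨j, k⟩
    rcases eq_or_ne j 0 with rfl | hj
    · have : F (0, k) = 0 := by simp [hF]
      rw [this, abs_zero]; exact hM0 _
    · simp only [hF, hM]
      have hshift : (if k = 0 ∨ k = j then (0 : ℝ) else truncWeight T k / (classicalLocationZ k - classicalLocationZ j) ^ 3) =
          (if j + (k - j) = 0 ∨ j + (k - j) = j then (0 : ℝ) else truncWeight T (j + (k - j)) / (classicalLocationZ (j + (k - j)) - classicalLocationZ j) ^ 3) := by
        rw [add_sub_cancel]
      have h1 : |(if k = 0 ∨ k = j then (0 : ℝ) else truncWeight T k / (classicalLocationZ k - classicalLocationZ j) ^ 3)| ≤ (4 * ((Q j) ^ 3 + logPlus (((k - j) : ℤ) : ℝ) ^ 3) / (c ^ 3 * |(((k - j) : ℤ) : ℝ)| ^ 3)) := by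
        rw [hshift]; exact abs_cubeTerm_shift_le_maj hc hB₈ h44 h43 hN0 hj le_rfl (k - j)
      rw [abs_mul, abs_mul, abs_mul, abs_of_pos (two_pos : (0:ℝ) < 2),
        abs_of_pos (truncWeight_pos hN0 j)]
      have h2 := hdev j
      have hψ := (truncWeight_pos hN0 j).le
      have h0 : 0 ≤ 2 * truncWeight T j * (Bp * C₈ * logPlus j) := by
        have := logPlus_nonneg (j : ℝ); positivity
      exact mul_le_mul (mul_le_mul_of_nonneg_left h2 (by positivity)) h1 (abs_nonneg _) h0
  -- rows of M
  have hMrow : ∀ j, Summable fun k ↦ M (j, k) := fun j ↦ by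
    have h1 : Summable ((fun m : ℤ ↦ 4 * ((Q j) ^ 3 + logPlus m ^ 3) / (c ^ 3 * |(m : ℝ)| ^ 3)) ∘ (Equiv.subRight j)) :=
      (Equiv.summable_iff _).2 (summable_maj (hQ0 j) hc)
    have h2 : Summable (fun k : ℤ ↦ (4 * ((Q j) ^ 3 + logPlus (((k - j) : ℤ) : ℝ) ^ 3) / (c ^ 3 * |(((k - j) : ℤ) : ℝ)| ^ 3))) := by
      simpa only [Function.comp_def, Equiv.subRight_apply] using h1
    simpa only [hM] using h2.mul_left (2 * truncWeight T j * (Bp * C₈ * logPlus j))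
  have hMrow_eq : ∀ j, ∑' k, M (j, k) =
      2 * truncWeight T j * (Bp * C₈ * logPlus j) * ∑' m : ℤ, (4 * ((Q j) ^ 3 + logPlus m ^ 3) / (c ^ 3 * |(m : ℝ)| ^ 3)) := fun j ↦ by
    have h1 := (Equiv.subRight j).tsum_eq (fun m : ℤ ↦ 4 * ((Q j) ^ 3 + logPlus m ^ 3) / (c ^ 3 * |(m : ℝ)| ^ 3))
    simp only [Equiv.subRight_apply] at h1
    simp only [hM]
    rw [tsum_mul_left, h1]
  -- row sums ≤ W · ψ_T(j) log₊⁴ j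
  have hD8 : 0 ≤ Real.log (2 + B₈) := Real.log_nonneg (by linarith)
  set q₀ : ℝ := Real.log (2 + B₈) / Real.log 2 + 2 with hq₀
  have hq₀0 : 0 ≤ q₀ := add_nonneg (div_nonneg hD8 hℓ.le) zero_le_two
  set W : ℝ := (4 * q₀ ^ 3 / c ^ 3) * 4 / Real.log 2 + (4 / c ^ 3) * S₃ / Real.log 2 ^ 4 with hW
  have hW0 : 0 ≤ W := by positivity
  have hQle : ∀ j : ℤ, Q j ≤ q₀ * logPlus j := by
    intro j
    have hL : Real.log 2 ≤ logPlus (j : ℝ) := log_two_le_logPlus _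
    have hD : 0 ≤ Real.log (2 + B₈) := Real.log_nonneg (by linarith)
    have : Real.log (2 + B₈) ≤ Real.log (2 + B₈) / Real.log 2 * logPlus (j : ℝ) := by
      rw [div_mul_eq_mul_div, le_div_iff₀ hℓ]; exact mul_le_mul_of_nonneg_left hL hD
    simp only [hQ, hq₀]; linarith
  have hmajsum_le : ∀ j : ℤ, ∑' m : ℤ, (4 * ((Q j) ^ 3 + logPlus m ^ 3) / (c ^ 3 * |(m : ℝ)| ^ 3)) ≤ W * logPlus j ^ 3 := by
    intro j
    have hL : Real.log 2 ≤ logPlus (j : ℝ) := log_two_le_logPlus _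
    have hL0 : 0 ≤ logPlus (j : ℝ) := logPlus_nonneg _
    have h1 := tsum_maj_le (hQ0 j) hc
    have h2 : Q j ^ 3 ≤ q₀ ^ 3 * logPlus j ^ 3 := by
      rw [← mul_pow]; exact pow_le_pow_left₀ (hQ0 j) (hQle j) 3
    have h3 : 4 * Q j ^ 3 / c ^ 3 * 4 ≤ 4 * (q₀ ^ 3 * logPlus j ^ 3) / c ^ 3 * 4 := by gcongr
    have h4 : logPlus (j : ℝ) ^ 3 ≤ logPlus j ^ 3 / Real.log 2 * 1 := by
      rw [mul_one, le_div_iff₀ hℓ]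
      have : Real.log 2 ≤ 1 := by
        have := Real.log_two_lt_d9; linarith
      calc logPlus (j : ℝ) ^ 3 * Real.log 2 ≤ logPlus (j : ℝ) ^ 3 * 1 :=
            mul_le_mul_of_nonneg_left this (by positivity)
        _ = logPlus (j : ℝ) ^ 3 := mul_one _
    have h5 : (1 : ℝ) ≤ logPlus j ^ 3 / Real.log 2 ^ 4 * Real.log 2 := by
      rw [div_mul_eq_mul_div, le_div_iff₀ (by positivity), one_mul,
        show Real.log 2 ^ 4 = Real.log 2 ^ 3 * Real.log 2 by ring]
      exact mul_le_mul_of_nonneg_right (pow_le_pow_left₀ hℓ.le hL 3) hℓ.le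
    have h6 : (4 / c ^ 3) * S₃ ≤ (4 / c ^ 3) * S₃ * (logPlus j ^ 3 / Real.log 2 ^ 4 * Real.log 2) :=
      le_mul_of_one_le_right (by positivity) h5
    have h7 : 4 * (q₀ ^ 3 * logPlus (j : ℝ) ^ 3) / c ^ 3 * 4 +
        (4 / c ^ 3) * S₃ * (logPlus j ^ 3 / Real.log 2 ^ 4 * Real.log 2) ≤ W * logPlus j ^ 3 := by
      have e : W * logPlus (j : ℝ) ^ 3 = 4 * (q₀ ^ 3 * logPlus (j : ℝ) ^ 3) / c ^ 3 * 4 / Real.log 2 +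
          (4 / c ^ 3) * S₃ * (logPlus j ^ 3 / Real.log 2 ^ 4) := by
        simp only [hW]; field_simp
      rw [e]
      have h8' : 4 * (q₀ ^ 3 * logPlus (j : ℝ) ^ 3) / c ^ 3 * 4 ≤
          4 * (q₀ ^ 3 * logPlus (j : ℝ) ^ 3) / c ^ 3 * 4 / Real.log 2 := by
        rw [le_div_iff₀ hℓ]
        have : Real.log 2 ≤ 1 := by have := Real.log_two_lt_d9; linarith
        calc 4 * (q₀ ^ 3 * logPlus (j : ℝ) ^ 3) / c ^ 3 * 4 * Real.log 2
            ≤ 4 * (q₀ ^ 3 * logPlus (j : ℝ) ^ 3) / c ^ 3 * 4 * 1 :=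
              mul_le_mul_of_nonneg_left this (by positivity)
          _ = _ := mul_one _
      have h9 : (4 / c ^ 3) * S₃ * (logPlus (j : ℝ) ^ 3 / Real.log 2 ^ 4 * Real.log 2) ≤
          (4 / c ^ 3) * S₃ * (logPlus j ^ 3 / Real.log 2 ^ 4) := by
        have : Real.log 2 ≤ 1 := by have := Real.log_two_lt_d9; linarith
        have h0 : 0 ≤ (4 / c ^ 3) * S₃ * (logPlus (j : ℝ) ^ 3 / Real.log 2 ^ 4) := by positivity
        calc (4 / c ^ 3) * S₃ * (logPlus (j : ℝ) ^ 3 / Real.log 2 ^ 4 * Real.log 2)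
            = (4 / c ^ 3) * S₃ * (logPlus (j : ℝ) ^ 3 / Real.log 2 ^ 4) * Real.log 2 := by ring
          _ ≤ (4 / c ^ 3) * S₃ * (logPlus (j : ℝ) ^ 3 / Real.log 2 ^ 4) * 1 :=
              mul_le_mul_of_nonneg_left this h0
          _ = _ := mul_one _
      linarith
    linarith
  have hrow_le : ∀ j : ℤ, ∑' k, M (j, k) ≤
      (2 * (Bp * C₈) * W) * (truncWeight T j * logPlus j ^ 4) := by
    intro j
    rw [hMrow_eq j]
    have hψ := (truncWeight_pos hN0 j).le
    have h0 : 0 ≤ 2 * truncWeight T j * (Bp * C₈ * logPlus j) := by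
      have := logPlus_nonneg (j : ℝ); positivity
    calc 2 * truncWeight T j * (Bp * C₈ * logPlus j) * ∑' m : ℤ, (4 * ((Q j) ^ 3 + logPlus m ^ 3) / (c ^ 3 * |(m : ℝ)| ^ 3))
        ≤ 2 * truncWeight T j * (Bp * C₈ * logPlus j) * (W * logPlus j ^ 3) :=
          mul_le_mul_of_nonneg_left (hmajsum_le j) h0
      _ = (2 * (Bp * C₈) * W) * (truncWeight T j * logPlus j ^ 4) := by ring
  obtain ⟨hW4s, -⟩ := tsum_truncWeight_mul_logPlus_pow_le hT (p := 4) (by norm_num)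
  have hMsum : Summable fun j ↦ ∑' k, M (j, k) :=
    Summable.of_nonneg_of_le (fun j ↦ tsum_nonneg fun k ↦ hM0 _) hrow_le (hW4s.mul_left _)
  have hMS : Summable M := (summable_prod_of_nonneg hM0).2 ⟨hMrow, hMsum⟩
  have hFS : Summable F :=
    Summable.of_norm_bounded hMS fun q ↦ by rw [Real.norm_eq_abs]; exact hFM q
  -- rows of F
  have hFrow : ∀ j, Summable fun k ↦ F (j, k) := by
    intro j
    rcases eq_or_ne j 0 with rfl | hj
    · have : (fun k ↦ F (0, k)) = fun _ ↦ 0 := by ext k; simp [hF]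
      rw [this]; exact summable_zero
    · have := (summable_cubeTerm hc hB₈ h44 h43 hN0 hj).2.mul_left
        (2 * truncWeight T j * (deBruijnZeroZ t j - classicalLocationZ j))
      simpa only [hF] using this
  refine ⟨hFS, fun j ↦ by simpa only [hF] using hFrow j, ?_⟩
  -- Fubini and the outer bound
  have hFub : ∑' q, F q = ∑' j, ∑' k, F (j, k) := hFS.tsum_prod' hFrow
  have hinner : ∀ j, ∑' k, F (j, k) =
      2 * truncWeight T j * (deBruijnZeroZ t j - classicalLocationZ j) *
        ∑' k : ℤ, (if k = 0 ∨ k = j then (0 : ℝ) else truncWeight T k / (classicalLocationZ k - classicalLocationZ j) ^ 3) :=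
    fun j ↦ by simp only [hF]; exact tsum_mul_left
  set R : ℤ → ℝ := fun j ↦ 2 * (Bp * C₈ * K) *
    (truncWeight T j * logPlus j ^ 5 / |(j : ℝ)| + (1 / N) * (truncWeight T j * logPlus j ^ 5))
    with hR
  obtain ⟨hW5ds, hW5d⟩ := tsum_truncWeight_mul_logPlus_pow_div_le hT (p := 5) (by norm_num)
  obtain ⟨hW5s, -⟩ := tsum_truncWeight_mul_logPlus_pow_le hT (p := 5) (by norm_num)
  have hW5 := tsum_truncWeight_mul_logPlus_pow_le' hT (p := 5) (by norm_num)
  have hRS : Summable R := (hW5ds.add (hW5s.mul_left _)).mul_left _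
  have hR_le : ∀ j, |∑' k, F (j, k)| ≤ R j := by
    intro j
    rw [hinner j]
    have hR0 : 0 ≤ R j := by
      have := logPlus_nonneg (j : ℝ)
      have := (truncWeight_pos hN0 j).le
      positivity
    rcases eq_or_ne j 0 with rfl | hj
    · rw [ha0]; simpa using hR0
    · obtain ⟨-, hSj⟩ := hcore T hT j hj
      have hψ := (truncWeight_pos hN0 j).le
      rw [abs_mul, abs_mul, abs_mul, abs_of_pos (two_pos : (0:ℝ) < 2), abs_of_pos (truncWeight_pos hN0 j)]
      calc 2 * truncWeight T j * |deBruijnZeroZ t j - classicalLocationZ j| *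
            |∑' k : ℤ, (if k = 0 ∨ k = j then (0 : ℝ) else truncWeight T k / (classicalLocationZ k - classicalLocationZ j) ^ 3)|
          ≤ 2 * truncWeight T j * (Bp * C₈ * logPlus j) *
              (K * logPlus j ^ 4 * (1 / |(j : ℝ)| + 1 / N)) :=
            mul_le_mul (mul_le_mul_of_nonneg_left (hdev j) (by positivity)) hSj (abs_nonneg _)
              (by have := logPlus_nonneg (j : ℝ); positivity)
        _ = R j := by simp only [hR]; ring
  have hnormS : Summable fun j ↦ ‖∑' k, F (j, k)‖ :=
    Summable.of_nonneg_of_le (fun j ↦ norm_nonneg _)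
      (fun j ↦ by rw [Real.norm_eq_abs]; exact hR_le j) hRS
  have h1 : |∑' q, F q| ≤ ∑' j, R j := by
    rw [hFub]
    refine le_trans ?_ (hnormS.tsum_le_tsum (fun j ↦ by rw [Real.norm_eq_abs]; exact hR_le j) hRS)
    have := norm_tsum_le_tsum_norm hnormS
    rw [Real.norm_eq_abs] at this
    exact this
  have h2 : ∑' j, R j = 2 * (Bp * C₈ * K) *
      (∑' j : ℤ, truncWeight T j * logPlus j ^ 5 / |(j : ℝ)| +
        (1 / N) * ∑' j : ℤ, truncWeight T j * logPlus j ^ 5) := by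
    simp only [hR]
    rw [tsum_mul_left, hW5ds.tsum_add (hW5s.mul_left _), tsum_mul_left]
  have h3 : (1 / N) * ∑' j : ℤ, truncWeight T j * logPlus j ^ 5 ≤ 10 * 3 ^ 5 * Real.log T ^ 5 := by
    calc (1 / N) * ∑' j : ℤ, truncWeight T j * logPlus j ^ 5
        ≤ (1 / N) * (10 * 3 ^ 5 * N * Real.log T ^ 5) := mul_le_mul_of_nonneg_left hW5 (by positivity)
      _ = 10 * 3 ^ 5 * Real.log T ^ 5 := by field_simp
  have h4 : Real.log T ^ 5 ≤ Real.log T ^ 6 := by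
    rw [show Real.log T ^ 6 = Real.log T ^ 5 * Real.log T by ring]
    exact le_mul_of_one_le_right (by positivity) hlogT
  have h5 : ∑' j : ℤ, truncWeight T j * logPlus j ^ 5 / |(j : ℝ)| +
      (1 / N) * ∑' j : ℤ, truncWeight T j * logPlus j ^ 5 ≤ 26 * 3 ^ 5 * Real.log T ^ 6 := by
    have := hW5d
    linarith
  have hBCK : 0 ≤ 2 * (Bp * C₈ * K) := by positivity
  calc |∑' q, F q| ≤ ∑' j, R j := h1
    _ = _ := h2
    _ ≤ 2 * (Bp * C₈ * K) * (26 * 3 ^ 5 * Real.log T ^ 6) := mul_le_mul_of_nonneg_left h5 hBCK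
    _ = 2 * K * C₈ * (26 * 3 ^ 5) * max B 0 * Real.log T ^ 6 := by simp only [hBp]; ring


/-- The symmetric family restricted to `ℤ* × ℤ* ∖ Δ` is summable and its sum is `−2 Σ F`
(swap-invariance of the `ℤ × ℤ`-sum). [cite: RodgersTaoFMP2020, Lemma 18 p. 42 (proof)] -/
private theorem summable_corrSym_subtype {T t : ℝ}
    (hFS : Summable (fun q : ℤ × ℤ ↦ (2 * truncWeight T q.1 * (deBruijnZeroZ t q.1 - classicalLocationZ q.1) * (if q.2 = 0 ∨ q.2 = q.1 then (0 : ℝ) else truncWeight T q.2 / (classicalLocationZ q.2 - classicalLocationZ q.1) ^ 3)))) :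
    Summable (fun p : zstarOffDiag ↦ (-(2 * truncWeight T p.1.2 * (deBruijnZeroZ t p.1.2 - classicalLocationZ p.1.2) * (if p.1.1 = 0 ∨ p.1.1 = p.1.2 then (0 : ℝ) else truncWeight T p.1.1 / (classicalLocationZ p.1.1 - classicalLocationZ p.1.2) ^ 3)) - (2 * truncWeight T p.1.1 * (deBruijnZeroZ t p.1.1 - classicalLocationZ p.1.1) * (if p.1.2 = 0 ∨ p.1.2 = p.1.1 then (0 : ℝ) else truncWeight T p.1.2 / (classicalLocationZ p.1.2 - classicalLocationZ p.1.1) ^ 3)))) ∧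
      ∑' p : zstarOffDiag, (-(2 * truncWeight T p.1.2 * (deBruijnZeroZ t p.1.2 - classicalLocationZ p.1.2) * (if p.1.1 = 0 ∨ p.1.1 = p.1.2 then (0 : ℝ) else truncWeight T p.1.1 / (classicalLocationZ p.1.1 - classicalLocationZ p.1.2) ^ 3)) - (2 * truncWeight T p.1.1 * (deBruijnZeroZ t p.1.1 - classicalLocationZ p.1.1) * (if p.1.2 = 0 ∨ p.1.2 = p.1.1 then (0 : ℝ) else truncWeight T p.1.2 / (classicalLocationZ p.1.2 - classicalLocationZ p.1.1) ^ 3))) =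
        -2 * ∑' q : ℤ × ℤ, (2 * truncWeight T q.1 * (deBruijnZeroZ t q.1 - classicalLocationZ q.1) * (if q.2 = 0 ∨ q.2 = q.1 then (0 : ℝ) else truncWeight T q.2 / (classicalLocationZ q.2 - classicalLocationZ q.1) ^ 3)) := by
  set F : ℤ × ℤ → ℝ := (fun q : ℤ × ℤ ↦ (2 * truncWeight T q.1 * (deBruijnZeroZ t q.1 - classicalLocationZ q.1) * (if q.2 = 0 ∨ q.2 = q.1 then (0 : ℝ) else truncWeight T q.2 / (classicalLocationZ q.2 - classicalLocationZ q.1) ^ 3))) with hF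
  set G : ℤ × ℤ → ℝ := fun q ↦ -F (q.2, q.1) - F q with hG
  have hswap0 : Summable (F ∘ (Equiv.prodComm ℤ ℤ)) := (Equiv.summable_iff _).2 hFS
  have hswap : Summable (fun q : ℤ × ℤ ↦ F (q.2, q.1)) := by
    simpa only [Function.comp_def, Equiv.prodComm_apply, Prod.swap] using hswap0
  have hGS : Summable G := hswap.neg.sub hFS
  have h1 : ∑' q : ℤ × ℤ, F (q.2, q.1) = ∑' q, F q := by
    have := (Equiv.prodComm ℤ ℤ).tsum_eq F
    simpa only [Equiv.prodComm_apply, Prod.swap] using this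
  have hGt : ∑' q, G q = -2 * ∑' q, F q := by
    have h2 : ∑' q : ℤ × ℤ, G q = ∑' q : ℤ × ℤ, (-F (q.2, q.1) - F q) := rfl
    rw [h2, hswap.neg.tsum_sub hFS, tsum_neg, h1]
    ring
  have hGq : ∀ q : ℤ × ℤ, G q = (-(2 * truncWeight T q.2 * (deBruijnZeroZ t q.2 - classicalLocationZ q.2) * (if q.1 = 0 ∨ q.1 = q.2 then (0 : ℝ) else truncWeight T q.1 / (classicalLocationZ q.1 - classicalLocationZ q.2) ^ 3)) - (2 * truncWeight T q.1 * (deBruijnZeroZ t q.1 - classicalLocationZ q.1) * (if q.2 = 0 ∨ q.2 = q.1 then (0 : ℝ) else truncWeight T q.2 / (classicalLocationZ q.2 - classicalLocationZ q.1) ^ 3))) := fun q ↦ by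
    simp only [hG, hF]
  have hsupp : Function.support G ⊆ zstarOffDiag := by
    intro q hq
    by_contra h
    exact hq ((hGq q).trans (corrSym_eq_zero h))
  refine ⟨(hGS.subtype zstarOffDiag).congr fun p ↦ hGq p.1, ?_⟩
  calc ∑' p : zstarOffDiag, (-(2 * truncWeight T p.1.2 * (deBruijnZeroZ t p.1.2 - classicalLocationZ p.1.2) * (if p.1.1 = 0 ∨ p.1.1 = p.1.2 then (0 : ℝ) else truncWeight T p.1.1 / (classicalLocationZ p.1.1 - classicalLocationZ p.1.2) ^ 3)) - (2 * truncWeight T p.1.1 * (deBruijnZeroZ t p.1.1 - classicalLocationZ p.1.1) * (if p.1.2 = 0 ∨ p.1.2 = p.1.1 then (0 : ℝ) else truncWeight T p.1.2 / (classicalLocationZ p.1.2 - classicalLocationZ p.1.1) ^ 3)))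
      = ∑' p : zstarOffDiag, G p.1 := tsum_congr fun p ↦ (hGq p.1).symm
    _ = ∑' q, G q := tsum_subtype_eq_of_support_subset hsupp
    _ = -2 * ∑' q, F q := hGt

end RodgersTaoTruncEnergyExpansion

/-! ## Part A — the RH-FREE display of p. 42, public form -/

open RodgersTaoTruncEnergyExpansion in
/-- RH-FREE CONTENT — the `t`-free display of the proof of Rodgers–Tao 2020 **Lemma 18** (FMP
p. 42; = v4 Lemma 7.3): «it will suffice to establish the bound
`Σ_{k ∈ ℤ* : k ≠ j} ψ_T(k)/(ξ_k − ξ_j)³ ≲ 1/|j| + 1/T` for all `j ∈ ℤ*`» (`≲` = up to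
`log^{O(1)}` factors, §1.2). Typed with explicit logarithmic losses: there is an absolute `K` such
that for all `T ≥ 3` and `j ∈ ℤ*` the family `k ↦ ψ_T(k)/(ξ_k − ξ_j)³` on `ℤ* ∖ {j}` is summable
and `|Σ'| ≤ K · log₊⁴ j · (1/|j| + 1/(T log T))`. A statement about the classical locations
`ξ_j = classicalLocationZ j` and the weight `ψ_T = truncWeight T` only; no hypothesis on `Λ`, no
zeros of `H_t`. Proof as printed: (44) on `|k − j| > |j|/2`; on the near range the corrected (45)
at `k = j ± n` (the main terms `(log(ξ_j/4π)/4π)³/(k − j)³` cancel in pairs — «`k ↦ 1/(k−j)` is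
odd around `j`»; only the second difference `(ξ_{j+n} − ξ_j) − (ξ_j − ξ_{j−n}) = O(n²/j)` enters)
and `ψ_T(k) = ψ_T(j) + O(|k − j|/(T log T))`. Inputs: `RodgersTao2020.lemma31_ii_holds_record`
(44), `RodgersTao2020.lemma31_iii_holds` (45, corrected form), `lemma8_i_order` (43).
[cite: RodgersTaoFMP2020, Lemma 18 p. 42 (proof, display «Σ_{k ∈ ℤ*: k ≠ j} ψ_T(k)/(ξ_k − ξ_j)³ ≲ 1/|j| + 1/T»)] -/
theorem abs_tsum_truncWeight_div_cube_le :
    ∃ K : ℝ, 0 ≤ K ∧ ∀ T : ℝ, 3 ≤ T → ∀ j : ℤ, j ≠ 0 →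
      Summable (fun k : zstarCompl {j} ↦
          truncWeight T k / (classicalLocationZ k - classicalLocationZ j) ^ 3) ∧
        |∑' k : zstarCompl {j},
            truncWeight T k / (classicalLocationZ k - classicalLocationZ j) ^ 3| ≤
          K * logPlus j ^ 4 * (1 / |(j : ℝ)| + 1 / (T * Real.log T)) := by
  obtain ⟨K, hK, h⟩ := abs_tsum_cubeTerm_le
  refine ⟨K, hK, fun T hT j hj ↦ ?_⟩
  obtain ⟨hs, hb⟩ := h T hT j hj
  obtain ⟨hiff, heq⟩ := tsum_subtype_eq_tsum_cubeTerm T j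
  exact ⟨hiff.2 hs, heq ▸ hb⟩

/-! ## Part B — Rodgers–Tao Lemma 18 as an RH-FREE schema, pointwise in `t` -/

open RodgersTaoTruncEnergyExpansion in
/-- RH-FREE CONTENT TWIN of Rodgers–Tao 2020 **Lemma 18** (= v4 Lemma 7.3 `eb2`; FMP p. 42:
«For almost every `Λ/2 ≤ t ≤ 0`, one has
`Ẽ_T(t) = (Σ_{j,k ∈ ℤ*: j ≠ k} ψ_T(j)ψ_T(k)(E_{jk}(t) − 1/|ξ_k − ξ_j|²)) + Õ(1)`»), in the house
schema form, POINTWISE in `t`: at any time `t` lying above a real-rooted time (so that the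
`ℤ*`-zeros are the genuine simple real zeros and (63) holds) at which the zeros obey the (50)-shape
location law `|x_n(t) − ξ_n| ≤ B log₊ ξ_n` (`n ≥ 1`; = the INNER shape of
`RodgersTao2020.cor33_location`, cf. t2's H2), and for every `T ≥ 3`:
(1) the (63)-correction family `ψ_T(j)ψ_T(k) · 2((x_k − ξ_k) − (x_j − ξ_j))/(ξ_k − ξ_j)³` is summable
on the pairs `j ≠ k` in `ℤ*`; (2) its sum is at most `C · max(B,0) · log⁶ T` in absolute value
(`Õ(1)` made explicit; `C` ABSOLUTE, i.e. uniform in `t` and linear in `B`); (3) `Ẽ_T(t)` is finite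
(summable) iff the displayed series `Σ ψψ(E_{jk} − 1/Δξ²)` is; (4) when it is,
`|Ẽ_T(t) − Σ' ψψ(E_{jk} − 1/(ξ_k − ξ_j)²)| ≤ C · max(B,0) · log⁶ T`. The printed «almost every `t`»
carries only Prop. 15's a.e.-finiteness of `Ẽ_T(t)`, which is an INPUT here (hypothesis of (4),
equivalence (3)); no statement about a.e. `t` is made. Proof = the printed one: (63)
(`renormEnergyZ_eq_interactionEnergy_sub`), desymmetrisation over `ℤ* × ℤ*` (Fubini on `ℤ × ℤ`
with the zero-extended summand `2ψ_T(j)(x_j − ξ_j)g_j(k)`, swap-invariance), the `p. 42` display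
`abs_tsum_truncWeight_div_cube_le` for the inner sums, and `Σ_j ψ_T(j) log₊⁵ j (1/|j| + 1/(T log T))
≲ log⁶ T`. No hypothesis `Λ < 0`, no `t ≤ 0`: (50) at `t > Λ ≥ 0` is NOT asserted — it is the
hypothesis. [cite: RodgersTaoFMP2020, Lemma 18 p. 42 (= arXiv:1801.05914v4 Lemma 7.3)] -/
theorem rodgers_tao_truncEnergy_expansion_of :
    ∃ C : ℝ, 0 ≤ C ∧ ∀ B T t : ℝ, 3 ≤ T →
      (∃ t₁ : ℝ, t₁ < t ∧ HasOnlyRealZeros (deBruijnH t₁)) →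
      (∀ n : ℕ, 1 ≤ n →
        |deBruijnZero t n - classicalLocation (n : ℝ)| ≤ B * logPlus (classicalLocation (n : ℝ))) →
      Summable (fun p : zstarOffDiag ↦ truncWeight T p.1.1 * truncWeight T p.1.2 *
          (2 * ((deBruijnZeroZ t p.1.2 - classicalLocationZ p.1.2) -
            (deBruijnZeroZ t p.1.1 - classicalLocationZ p.1.1)) /
            (classicalLocationZ p.1.2 - classicalLocationZ p.1.1) ^ 3)) ∧
      |∑' p : zstarOffDiag, truncWeight T p.1.1 * truncWeight T p.1.2 *
          (2 * ((deBruijnZeroZ t p.1.2 - classicalLocationZ p.1.2) -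
            (deBruijnZeroZ t p.1.1 - classicalLocationZ p.1.1)) /
            (classicalLocationZ p.1.2 - classicalLocationZ p.1.1) ^ 3)| ≤
        C * max B 0 * Real.log T ^ 6 ∧
      (Summable (truncEnergyTerm T t) ↔
        Summable (fun p : zstarOffDiag ↦ truncWeight T p.1.1 * truncWeight T p.1.2 *
          (interactionEnergy t p.1.1 p.1.2 -
            1 / (classicalLocationZ p.1.2 - classicalLocationZ p.1.1) ^ 2))) ∧
      (Summable (truncEnergyTerm T t) →
        |truncEnergy T t - ∑' p : zstarOffDiag, truncWeight T p.1.1 * truncWeight T p.1.2 *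
            (interactionEnergy t p.1.1 p.1.2 -
              1 / (classicalLocationZ p.1.2 - classicalLocationZ p.1.1) ^ 2)| ≤
          C * max B 0 * Real.log T ^ 6) := by
  obtain ⟨C, hC, hmain⟩ := abs_tsum_desym_le
  refine ⟨2 * C, by positivity, fun B T t hT hΛ h50 ↦ ?_⟩
  obtain ⟨hFS, -, hbd⟩ := hmain B T t hT h50
  obtain ⟨hGS, hGt⟩ := summable_corrSym_subtype hFS
  -- names for the three families
  set corr : zstarOffDiag → ℝ := fun p ↦ truncWeight T p.1.1 * truncWeight T p.1.2 *
      (2 * ((deBruijnZeroZ t p.1.2 - classicalLocationZ p.1.2) -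
        (deBruijnZeroZ t p.1.1 - classicalLocationZ p.1.1)) /
        (classicalLocationZ p.1.2 - classicalLocationZ p.1.1) ^ 3) with hcorr
  set main : zstarOffDiag → ℝ := fun p ↦ truncWeight T p.1.1 * truncWeight T p.1.2 *
      (interactionEnergy t p.1.1 p.1.2 -
        1 / (classicalLocationZ p.1.2 - classicalLocationZ p.1.1) ^ 2) with hmain'
  have hcorr_eq : corr = fun p : zstarOffDiag ↦ (-(2 * truncWeight T p.1.2 * (deBruijnZeroZ t p.1.2 - classicalLocationZ p.1.2) * (if p.1.1 = 0 ∨ p.1.1 = p.1.2 then (0 : ℝ) else truncWeight T p.1.1 / (classicalLocationZ p.1.1 - classicalLocationZ p.1.2) ^ 3)) - (2 * truncWeight T p.1.1 * (deBruijnZeroZ t p.1.1 - classicalLocationZ p.1.1) * (if p.1.2 = 0 ∨ p.1.2 = p.1.1 then (0 : ℝ) else truncWeight T p.1.2 / (classicalLocationZ p.1.2 - classicalLocationZ p.1.1) ^ 3))) :=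
    funext fun p ↦ (corrSym_eq p).symm
  have hcorrS : Summable corr := by rw [hcorr_eq]; exact hGS
  have hcorrT : ∑' p, corr p = -2 * ∑' q : ℤ × ℤ, (2 * truncWeight T q.1 * (deBruijnZeroZ t q.1 - classicalLocationZ q.1) * (if q.2 = 0 ∨ q.2 = q.1 then (0 : ℝ) else truncWeight T q.2 / (classicalLocationZ q.2 - classicalLocationZ q.1) ^ 3)) := by
    rw [hcorr_eq]; exact hGt
  have hcorr_bd : |∑' p, corr p| ≤ 2 * C * max B 0 * Real.log T ^ 6 := by
    rw [hcorrT, abs_mul, show |(-2 : ℝ)| = 2 by norm_num]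
    linarith [hbd]
  -- (63) termwise
  have h63 : ∀ p : zstarOffDiag, truncEnergyTerm T t p = main p + corr p := by
    intro p
    rw [truncEnergyTerm_eq, renormEnergyZ_eq_interactionEnergy_sub hΛ p.2.2.2]
    simp only [hmain', hcorr]
    ring
  have h63' : truncEnergyTerm T t = fun p ↦ main p + corr p := funext h63
  have hiff : Summable (truncEnergyTerm T t) ↔ Summable main := by
    rw [h63']
    constructor
    · intro h
      have := h.sub hcorrS
      simpa using this
    · intro h
      exact h.add hcorrS
  refine ⟨hcorrS, hcorr_bd, hiff, fun hsum ↦ ?_⟩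
  have hmainS : Summable main := hiff.1 hsum
  have hE : truncEnergy T t = ∑' p, main p + ∑' p, corr p := by
    rw [truncEnergy_eq, h63']
    exact hmainS.tsum_add hcorrS
  rw [hE, add_sub_cancel_left]
  exact hcorr_bd

/-! ## Part C — the as-printed Lemma 18 from Corollary 10 (50) and the a.e. finiteness of `Ẽ_T` -/

/-- **The printed Lemma 18 follows from the printed Corollary 10 (50) and the a.e. finiteness of
`Ẽ_T(t)`** — the as-printed reduction. Both `RodgersTao2020.cor33_location` and
`rodgers_tao_truncEnergy_expansion` carry the §1.2 standing hypothesis `Λ < 0` (witness `t₀ < 0`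
with `H_{t₀}` real-rooted), so both are VACUOUS-AS-PRINTED in the tree; the implication itself is
RH-free content: instance `t ∈ [t₀/2, 0]`, `B = ` the (50)-constant, of
`rodgers_tao_truncEnergy_expansion_of`, with `A = 6`. The second hypothesis is the first sentence
of FMP p. 42 after (67) («from Proposition 15, (66), (62) and Fubini's theorem we see that `Ẽ_T`
is absolutely integrable in time (in particular, it is finite for almost every `Λ/2 ≤ t ≤ 0`)»),
stated INLINE in its typed shape (`∃ T₁, ∀ T ≥ T₁, ∀ᵐ t ∈ [t₀/2, 0], Summable (truncEnergyTerm T t)`);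
it is not a named fact of this file. No second `_holds` is recorded for
`rodgers_tao_truncEnergy_expansion` (its EX-FALSO discharge of record is
`rodgers_tao_truncEnergy_expansion_holds`). [cite: RodgersTaoFMP2020, Lemma 18 p. 42 (= arXiv:1801.05914v4 Lemma 7.3)] -/
theorem rodgers_tao_truncEnergy_expansion_of_cor33_location (h50 : RodgersTao2020.cor33_location)
    (hfin : ∀ t₀ : ℝ, t₀ < 0 → HasOnlyRealZeros (deBruijnH t₀) →
      ∃ T₁ : ℝ, ∀ T : ℝ, T₁ ≤ T →
        ∀ᵐ t ∂(volume.restrict (Icc (t₀ / 2) 0)), Summable (truncEnergyTerm T t)) :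
    rodgers_tao_truncEnergy_expansion := by
  intro t₀ ht₀ hreal
  obtain ⟨A50, hA50⟩ := h50
  obtain ⟨C, hC, hsch⟩ := rodgers_tao_truncEnergy_expansion_of
  obtain ⟨T₁, hT₁⟩ := hfin t₀ ht₀ hreal
  refine ⟨6, C * max A50 0, max T₁ 3, fun T hT ↦ ?_⟩
  have hT3 : 3 ≤ T := le_trans (le_max_right _ _) hT
  have hT1 : T₁ ≤ T := le_trans (le_max_left _ _) hT
  have hmem : ∀ᵐ t ∂(volume.restrict (Icc (t₀ / 2) 0)), t ∈ Icc (t₀ / 2) 0 :=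
    ae_restrict_mem measurableSet_Icc
  filter_upwards [hT₁ T hT1, hmem] with t hsum ht
  have hΛ : ∃ t₁ : ℝ, t₁ < t ∧ HasOnlyRealZeros (deBruijnH t₁) :=
    ⟨t₀, by linarith [ht.1], hreal⟩
  have h50t : ∀ n : ℕ, 1 ≤ n → |deBruijnZero t n - classicalLocation (n : ℝ)| ≤
      A50 * logPlus (classicalLocation (n : ℝ)) :=
    fun n hn ↦ hA50 t hΛ ht.2 n hn
  obtain ⟨-, -, hiff, hbd⟩ := hsch A50 T t hT3 hΛ h50t
  refine ⟨hsum, hiff.1 hsum, ?_⟩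
  have hpow : Real.log T ^ (6 : ℝ) = Real.log T ^ 6 := by
    rw [show (6 : ℝ) = ((6 : ℕ) : ℝ) by norm_num, Real.rpow_natCast]
  rw [hpow]
  have := hbd hsum
  linarith [this]


end Literature.NumberTheory.LFunctions

end
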